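import Literature.MathematicalPhysics.QuantumFieldTheory.Balaban1983to89.B1Eq324BenfattoSect5ErrTermLedger
import Literature.MathematicalPhysics.QuantumFieldTheory.Balaban1983to89.B1Eq324GaussianMomentLeaf
import HarnessLib

/-!
# `Balaban1983to89.B1Eq324BenfattoSect5LedgerDischarge` — [BenfattoEtAl1978] p. 152 (4.6)–(4.7), p. 159 «Collecting all the errors made in this process»
# and «b* = max{10⁴, γ⁻³b̄}»: THE LEDGER DISCHARGE TOOLKIT — a parameter choice from ONE free-field threshold `b*` (free of `t, D, ϰ`), the
# TWO-REGIME absorption of every per-step loss into `|I|·errTerm S ρ₁ ρ₂ ρ₃ ρ₄ A b t`, and the side conditions of the pavement chains — PROVED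

statement-level skeleton of published theorems with citation tags; proofs where landed; nothing here is a claim about the
Yang–Mills mass gap

WHY THIS MODULE (cell `pub-ymgap`, seat `dag-n08-b` gen 6; node N08 [Balaban1985UV3]; obligation (O2)/(O2′) of `…Sect5CollectErrors.ineq47_of_chain` /
`…Sect5PavementChainUpper.ineq46_of_chain`, i.e. the «pure real analysis on the ledger» left after the assembler's `…Sect5LowerAssembly`).
The typed target `B1Eq324BenfattoLemma.BasicLemma d α β` quantifies `∃ b*, ∀ t D ϰ, ∃ S ρ₁ … ρ₄, ∀ s b > b*, …`: the threshold `b*` is chosen BEFORE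
`t, D, ϰ` (print: `b* = max{10⁴, γ⁻³b̄}`, a constant of the free field).  Print's parameters (tesserae `L = ⌈b²⌉`, corridors `v = ⌈M·b^{3/2}⌉`, `w = 2v`)
make the displaced pavements fit only for `b ≥ (10(d+1)(M+1))²` (`…ErrTermLedger.shifts_fit`), and the corridor multiplier `M` must dominate
`(ρ₃ + 1)/c` for every decay rate `c` of the expansion with `ρ₃ ≥ D + 2d` (the `e^{2K}` factor of (5.19)–(5.20), `K = 4s₁Ab^{D}L^{d}`) — a threshold
depending on `D, t, ϰ`.  The way out, inside the proof and without touching the statement: for `b* < b < b₀` (the BOUNDED regime) run the same chains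
with the narrow corridors `v = 1, w = 2` (every hypothesis of the step theorems holds from a `(d, α, β)`-only threshold), and absorb every loss — now
`≤ C(t,D,d,ϰ,…)·b₀^{q}·A^{j}·|I|` — into the SAME constants through `e^{−ρ₃b^{3/2}} ≥ e^{−ρ₃b₀^{3/2}}`; for `b ≥ b₀` use print's wide corridors.  This file
proves the real-analysis lemmas of that scheme; which losses occur is the assembler's list.

WHAT IS PROVED (theorems only; no definition, no named fact, no `sorry`; axioms standard).
* §1 absorption shapes completing `…ErrTermLedger` §2: `pow_le_factorial_mul_exp` (`A^j ≤ j!e^{ρ₄Ab^{ρ₃}}`), ★ `bounded_regime_le_snd` (shape (v):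
  `C·b^q·A^j ≤ (C·b₀^q·j!·e^{ρ₃b₀^{3/2}})·e^{−ρ₃b^{3/2}}e^{ρ₄Ab^{ρ₃}}` on `1 ≤ b ≤ b₀`), ★★ `decay_atom_le_snd` (shape (ii) in BOTH regimes from
  `b₀ ≤ b → M·b^{3/2} ≤ X`), ★ `pow_atom_le_snd` ((ii′), `θ^n`, both regimes), ★ `gauss_atom_le_snd` ((iii) carrying `A^j`), `min_one_mul_rpow_le`,
  `exp_neg_rpow_cutoff_le` (the fractional power `(min 1 (P·e^{−c²/4}))^{r} ≤ P·e^{−(√r·γ′b)²/4}` of the `χ → 1` term).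
* §2 print's parameters in both regimes (`L = ⌈b²⌉₊`, `v = if b₀ ≤ b then ⌈M·b^{3/2}⌉₊ else 1`, `w = 2v`; the wide regime is the assembler's DESIGN-NOTE,
  cell bus 2026-08-27 l.21879, reading confirmed l.23938): `natCeil_sq_pos`, `one_le_regimeV`, `le_two_mul_and_one_le`,
  `wide_of_regime` (`b₀ ≤ b → M·b^{3/2} ≤ v`), `wide_mono`, ★ `shifts_fit_regime` (`(d+1)·2(2w+v) ≤ L` in both regimes), `lt_of_succ_mul_le`
  (`2(2w+v) < L`), ★ `natCeil_sq_pow_mul_exp_le` (the small-field volume hypothesis `L^d·e^{−c²/4} ≤ 1/6` at every cut-off `c ≥ γ′b` from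
  `6·2^d·(d+1)!·(4/γ′²)^{d+1} ≤ b²`), `sqrt_mul_natCeil_sq_lt_cube` (far conditioning: `√d(L−1) < b³` for `b > 2√d`), `lt_pow_mul_of_div_lt` (`b̄ < γ^{n}b`).
* §3 normal forms at a cut-off `0 ≤ c ≤ Γ·b` and side `L ≤ 2b²` (`Γ = 1` on the lower chain `c = γ^k b`, `Γ = γ^{−(d+1)}` on the upper chain
  `c = b/γ^{k+1}`): `cutoff_pow_le`, `side_pow_le`, `cutoff_pow_mul_side_pow_le`, `sum_adm_geom_nonneg_le` (the mass sums are `≥ 0` and `s`-uniform),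
  ★ `K_le` (`K = 4s₁Ac^DL^d ≤ (4s₁(D)Γ^D2^d)·(A·b^{D+2d})`), `one_add_cutoff_pow_le`, `K0_le`.
* §4 the per-box error of `…Sect5PerBoxErrBound.perBoxErr_le` (the `Err` of `…PerBoxAtPavement.perBox_at_pavement` with `|shrink| ↦ L^d`, Γ₁-weight `↦
  L^d(1+√d(L−1))`), ATOM BY ATOM at a cut-off `c`, each `≤ S_atom·(first | second summand of errTerm)` with `S_atom` closed and free of `s, b, c, A, L, |I|`:
  `unitK_le`, ★ `errPB_remainder_le` ((g) `2·2^{C(t+1,2)}K^{t+1}/(t+1)!` → first summand, `D+2d ≤ ρ₁`), ★ `errPB_volume_le` ((h) `e^{2K}·3L^de^{−c²/4}` → second,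
  `8s₁(D)Γ^D2^d ≤ ρ₄`, `D+2d ≤ ρ₃`), ★ `errPB_eps_le` ((i1) `3^{k+1}(Σ_π)·εK^k`, both regimes, rate `ϰ/4`), ★★ `errPB_chi_le` ((i2) the `χ → 1` constant `cχ(k+1)`
  with its fractional power, Gaussian at `√(1/(2(k+1)))·γ′b`), ★ `errPB_d29_le` ((i3) `δ₂₉(k+1)`, both regimes, rate `δ/2`), ★★ `errPB_d31_le` ((i4) `δ₃₁(k+1)`,
  both regimes, `θ^{w−v}` with `(−log θ)·M ≥ ρ₃+1`).
SEQUEL (same seat, next modules): the cumulant-side atoms of `…StepBound.exists_lower_step`/`exists_upper_step` ((5.11), (5.34), CROSS, W₂₉), the structural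
`e₅₁₁/e₅₃₄` and Appendix-A atoms, and `ledger_lower`/`ledger_upper` against the assembler's `…LowerAssembly.ineq47_of_ledger` hypothesis.

HONEST SCOPE / NOT HERE.  Elementary real analysis; no measure theory.  The list of losses (the assembler's `RAW`), the chains, `basicLemma_consts` and
`BasicLemma`/`BasicLemmaPrinted` are NOT here; count-neutral for N08; nothing of [Balaban1985UV3] (41)/(47)/(5) is asserted; nothing about d = 4, the
continuum, OS axioms, a mass gap or the Clay problem.
-/

noncomputable section

open Finset
open scoped BigOperators Nat

namespace Literature.MathematicalPhysics.QuantumFieldTheory.Balaban1983to89.B1Eq324BenfattoSect5LedgerDischarge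

open Literature.MathematicalPhysics.QuantumFieldTheory.Balaban1983to89.B1Eq324BenfattoLemma
open Literature.MathematicalPhysics.QuantumFieldTheory.Balaban1983to89.B1Eq324BenfattoSect5ErrTermAbsorb
open Literature.MathematicalPhysics.QuantumFieldTheory.Balaban1983to89.B1Eq324BenfattoSect5ErrTermLedger
open Literature.MathematicalPhysics.QuantumFieldTheory.Balaban1983to89.B1Eq324BenfattoSect5Eq511 (decayConst s1Const)
open Literature.MathematicalPhysics.QuantumFieldTheory.Balaban1983to89.B1Eq324GaussianMomentLeaf (momentConst)
open Literature.Probability.LatticeModels (setPartitions)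

/-! ## §1  Absorption shapes: the bounded regime, the two-regime decay atom, the `A^j`-carrying Gaussian atom -/

section Shapes

variable {A b b₀ ρ₃ ρ₄ : ℝ}

/-- `A^j ≤ j!·e^{ρ₄Ab^{ρ₃}}` for `A ≥ 0`, `b ≥ 1`, `ρ₃ ≥ 0`, `ρ₄ ≥ 1` (`A^j/j! ≤ e^{A} ≤ e^{ρ₄Ab^{ρ₃}}`): every power of the coefficient bound
`A` is paid for by the factor `e^{ρ₄Ab^{ρ₃}}` of the second summand of `errTerm`. [cite: BenfattoEtAl1978, (4.6)–(4.7) p.152] -/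
theorem pow_le_factorial_mul_exp (hA : 0 ≤ A) (hb : 1 ≤ b) (hρ₃ : 0 ≤ ρ₃) (hρ₄ : 1 ≤ ρ₄) (j : ℕ) :
    A ^ j ≤ (j.factorial : ℝ) * Real.exp (ρ₄ * A * b ^ ρ₃) := by
  have h1 : A ^ j / (j.factorial : ℝ) ≤ Real.exp A := Real.pow_div_factorial_le_exp A hA j
  have hj : (0 : ℝ) < j.factorial := by exact_mod_cast Nat.factorial_pos j
  have h2 : A ^ j ≤ (j.factorial : ℝ) * Real.exp A := by
    rw [div_le_iff₀ hj] at h1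
    linarith
  refine h2.trans (mul_le_mul_of_nonneg_left (Real.exp_le_exp.mpr ?_) hj.le)
  have hb1 : 1 ≤ b ^ ρ₃ := Real.one_le_rpow hb hρ₃
  have h' : A * 1 ≤ A * b ^ ρ₃ := mul_le_mul_of_nonneg_left hb1 hA
  have h'' : A * b ^ ρ₃ ≤ ρ₄ * (A * b ^ ρ₃) := le_mul_of_one_le_left (mul_nonneg hA (zero_le_one.trans hb1)) hρ₄
  linarith [mul_assoc ρ₄ A (b ^ ρ₃)]

/-- **SHAPE (v): THE BOUNDED REGIME.**  On `1 ≤ b ≤ b₀` a loss `C·b^q·A^j` with no decay at all fits the second summand: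
`C·b^q·A^j ≤ (C·b₀^q·j!·e^{ρ₃b₀^{3/2}})·e^{−ρ₃b^{3/2}}·e^{ρ₄Ab^{ρ₃}}` (`A, C ≥ 0`, `ρ₃ ≥ 0`, `ρ₄ ≥ 1`) — the constant remembers `b₀` only.
[cite: BenfattoEtAl1978, (4.6)–(4.7) p.152, p.159 «b* = max{10⁴, γ⁻³b̄}»] -/
theorem bounded_regime_le_snd {C : ℝ} (hC : 0 ≤ C) (hA : 0 ≤ A) (hb : 1 ≤ b) (hbb₀ : b ≤ b₀) (hρ₃ : 0 ≤ ρ₃) (hρ₄ : 1 ≤ ρ₄) (q j : ℕ) :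
    C * b ^ q * A ^ j ≤ (C * b₀ ^ q * j.factorial * Real.exp (ρ₃ * b₀ ^ (3 / 2 : ℝ))) *
      (Real.exp (-(ρ₃ * b ^ (3 / 2 : ℝ))) * Real.exp (ρ₄ * A * b ^ ρ₃)) := by
  have hb0 : 0 ≤ b := zero_le_one.trans hb
  have hb₀0 : 0 ≤ b₀ := hb0.trans hbb₀
  have hq : b ^ q ≤ b₀ ^ q := pow_le_pow_left₀ hb0 hbb₀ q
  have hj := pow_le_factorial_mul_exp hA hb hρ₃ hρ₄ j
  -- `1 ≤ e^{ρ₃b₀^{3/2}}·e^{−ρ₃b^{3/2}}` on `b ≤ b₀`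
  have hkey : 1 ≤ Real.exp (ρ₃ * b₀ ^ (3 / 2 : ℝ)) * Real.exp (-(ρ₃ * b ^ (3 / 2 : ℝ))) := by
    rw [← Real.exp_add]
    refine Real.one_le_exp (by nlinarith [Real.rpow_le_rpow hb0 hbb₀ (by norm_num : (0 : ℝ) ≤ 3 / 2)])
  calc C * b ^ q * A ^ j ≤ C * b₀ ^ q * ((j.factorial : ℝ) * Real.exp (ρ₄ * A * b ^ ρ₃)) := by gcongr
    _ = C * b₀ ^ q * j.factorial * Real.exp (ρ₄ * A * b ^ ρ₃) * 1 := by ring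
    _ ≤ C * b₀ ^ q * j.factorial * Real.exp (ρ₄ * A * b ^ ρ₃) *
          (Real.exp (ρ₃ * b₀ ^ (3 / 2 : ℝ)) * Real.exp (-(ρ₃ * b ^ (3 / 2 : ℝ)))) :=
        mul_le_mul_of_nonneg_left hkey (by positivity)
    _ = _ := by ring

/-- **SHAPE (ii) IN BOTH REGIMES: the decay atom `C·b^q·A^j·e^{−cX}`.**  If the corridor width `X ≥ 0` satisfies `M·b^{3/2} ≤ X` WHENEVER `b₀ ≤ b`
(the wide regime), `ρ₃ + 1 ≤ c·M`, `c ≥ 0`, `ρ₃ ≥ 0`, `ρ₄ ≥ 1`, `b ≥ 1`, `b₀ ≥ 0`, `A, C ≥ 0`, then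
`C·b^q·A^j·e^{−cX} ≤ (C·j!·(q! + b₀^q·e^{ρ₃b₀^{3/2}}))·e^{−ρ₃b^{3/2}}·e^{ρ₄Ab^{ρ₃}}`: the wide regime by `…ErrTermLedger.poly_mul_exp_neg_le_snd`,
the bounded regime (`b < b₀`, `e^{−cX} ≤ 1`) by `bounded_regime_le_snd`; one constant serves both.
[cite: BenfattoEtAl1978, (5.11) p.155, (5.29) p.157, (5.34) p.159, (4.7) p.152, p.159] -/
theorem decay_atom_le_snd {C c X M : ℝ} (hC : 0 ≤ C) (hA : 0 ≤ A) (hb : 1 ≤ b) (hb₀ : 0 ≤ b₀) (hρ₃ : 0 ≤ ρ₃) (hρ₄ : 1 ≤ ρ₄)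
    (hc : 0 ≤ c) (hX : 0 ≤ X) (hreg : b₀ ≤ b → M * b ^ (3 / 2 : ℝ) ≤ X) (hM : ρ₃ + 1 ≤ c * M) (q j : ℕ) :
    C * b ^ q * A ^ j * Real.exp (-(c * X)) ≤
      (C * j.factorial * (q.factorial + b₀ ^ q * Real.exp (ρ₃ * b₀ ^ (3 / 2 : ℝ)))) *
        (Real.exp (-(ρ₃ * b ^ (3 / 2 : ℝ))) * Real.exp (ρ₄ * A * b ^ ρ₃)) := by
  have hb0 : 0 ≤ b := zero_le_one.trans hb
  have hsnd : 0 ≤ Real.exp (-(ρ₃ * b ^ (3 / 2 : ℝ))) * Real.exp (ρ₄ * A * b ^ ρ₃) := by positivity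
  have hS₁ : 0 ≤ C * (q.factorial : ℝ) * j.factorial := by positivity
  have hS₂ : 0 ≤ C * b₀ ^ q * j.factorial * Real.exp (ρ₃ * b₀ ^ (3 / 2 : ℝ)) := by positivity
  have hsplit : (C * j.factorial * (q.factorial + b₀ ^ q * Real.exp (ρ₃ * b₀ ^ (3 / 2 : ℝ)))) *
        (Real.exp (-(ρ₃ * b ^ (3 / 2 : ℝ))) * Real.exp (ρ₄ * A * b ^ ρ₃)) =
      (C * q.factorial * j.factorial) * (Real.exp (-(ρ₃ * b ^ (3 / 2 : ℝ))) * Real.exp (ρ₄ * A * b ^ ρ₃)) +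
      (C * b₀ ^ q * j.factorial * Real.exp (ρ₃ * b₀ ^ (3 / 2 : ℝ))) * (Real.exp (-(ρ₃ * b ^ (3 / 2 : ℝ))) * Real.exp (ρ₄ * A * b ^ ρ₃)) := by
    ring
  rw [hsplit]
  by_cases hwide : b₀ ≤ b
  · have h := poly_mul_exp_neg_le_snd (ρ₄ := ρ₄) hC hA hb hρ₃ hρ₄ hc (hreg hwide) hM q j
    exact h.trans (le_add_of_nonneg_right (mul_nonneg hS₂ hsnd))
  · have hbb₀ : b ≤ b₀ := (not_le.mp hwide).le
    have hdecay : Real.exp (-(c * X)) ≤ 1 := Real.exp_le_one_iff.mpr (by nlinarith)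
    have h0 : 0 ≤ C * b ^ q * A ^ j := by positivity
    calc C * b ^ q * A ^ j * Real.exp (-(c * X)) ≤ C * b ^ q * A ^ j * 1 := mul_le_mul_of_nonneg_left hdecay h0
      _ = C * b ^ q * A ^ j := mul_one _
      _ ≤ (C * b₀ ^ q * j.factorial * Real.exp (ρ₃ * b₀ ^ (3 / 2 : ℝ))) *
            (Real.exp (-(ρ₃ * b ^ (3 / 2 : ℝ))) * Real.exp (ρ₄ * A * b ^ ρ₃)) := bounded_regime_le_snd hC hA hb hbb₀ hρ₃ hρ₄ q j
      _ ≤ _ := le_add_of_nonneg_left (mul_nonneg hS₁ hsnd)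

/-- **SHAPE (ii′) IN BOTH REGIMES: the atom `C·b^q·A^j·θⁿ`, `0 < θ < 1`** (the (5.31) «(error)» at depth `n = w − v`): if `M·b^{3/2} ≤ n` whenever
`b₀ ≤ b`, `ρ₃ + 1 ≤ (−log θ)·M`, `ρ₃ ≥ 0`, `ρ₄ ≥ 1`, `b ≥ 1`, `b₀ ≥ 0`, `A, C ≥ 0`, then
`C·b^q·A^j·θⁿ ≤ (C·j!·(q! + b₀^q·e^{ρ₃b₀^{3/2}}))·e^{−ρ₃b^{3/2}}·e^{ρ₄Ab^{ρ₃}}`. [cite: BenfattoEtAl1978, (5.31) p.158, (C.8) p.165, (4.7) p.152, p.159] -/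
theorem pow_atom_le_snd {C θ M : ℝ} {n : ℕ} (hC : 0 ≤ C) (hA : 0 ≤ A) (hb : 1 ≤ b) (hb₀ : 0 ≤ b₀) (hρ₃ : 0 ≤ ρ₃) (hρ₄ : 1 ≤ ρ₄)
    (hθ0 : 0 < θ) (hθ1 : θ < 1) (hreg : b₀ ≤ b → M * b ^ (3 / 2 : ℝ) ≤ n) (hM : ρ₃ + 1 ≤ -Real.log θ * M) (q j : ℕ) :
    C * b ^ q * A ^ j * θ ^ n ≤
      (C * j.factorial * (q.factorial + b₀ ^ q * Real.exp (ρ₃ * b₀ ^ (3 / 2 : ℝ)))) *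
        (Real.exp (-(ρ₃ * b ^ (3 / 2 : ℝ))) * Real.exp (ρ₄ * A * b ^ ρ₃)) := by
  -- `θⁿ = e^{−(−log θ)·n}`
  have hθn : θ ^ n = Real.exp (-(-Real.log θ * n)) := by
    rw [neg_mul, neg_neg, mul_comm, ← Real.log_pow, Real.exp_log (pow_pos hθ0 n)]
  rw [hθn]
  have hlog : 0 ≤ -Real.log θ := by
    have := Real.log_neg hθ0 hθ1
    linarith
  exact decay_atom_le_snd hC hA hb hb₀ hρ₃ hρ₄ hlog (Nat.cast_nonneg n) hreg hM q j

/-- **SHAPE (iii) CARRYING `A^j`: the Gaussian atom `C·b^q·A^j·e^{c₂Ab^{p}}·e^{−(γ′b)²/4}`** (the small-field volume `e^{2K}·3|□|e^{−b_k²/4}` and the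
`χ → 1` factor of (5.29) at the cut-off `b_k ≥ γ′b`): for `0 < γ′`, `b ≥ 1`, `A, C ≥ 0`, `0 ≤ p ≤ ρ₃`, `0 ≤ c₂`, `c₂ + 1 ≤ ρ₄`, with
`ρ := (ρ₃ + 1)/γ′^{3/2}`: `C·b^q·A^j·e^{c₂Ab^{p}}·e^{−(γ′b)²/4} ≤ (C·q!·j!·e^{27ρ⁴/4})·e^{−ρ₃b^{3/2}}·e^{ρ₄Ab^{ρ₃}}` — `A^j ≤ j!e^{A} ≤ j!e^{A·b^{p}}`
then `…ErrTermLedger.poly_mul_gauss_le_snd` at `c₂ + 1`. [cite: BenfattoEtAl1978, (5.19)–(5.20) p.156, (5.29) p.157, (4.7) p.152] -/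
theorem gauss_atom_le_snd {C c₂ p γ' : ℝ} (hC : 0 ≤ C) (hA : 0 ≤ A) (hb : 1 ≤ b) (hρ₃ : 0 ≤ ρ₃) (hγ' : 0 < γ') (hp0 : 0 ≤ p) (hp : p ≤ ρ₃)
    (hc₂ : 0 ≤ c₂) (hc₂' : c₂ + 1 ≤ ρ₄) (q j : ℕ) :
    C * b ^ q * A ^ j * Real.exp (c₂ * A * b ^ p) * Real.exp (-((γ' * b) ^ 2 / 4)) ≤
      (C * q.factorial * j.factorial * Real.exp (27 / 4 * ((ρ₃ + 1) / γ' ^ (3 / 2 : ℝ)) ^ 4)) *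
        (Real.exp (-(ρ₃ * b ^ (3 / 2 : ℝ))) * Real.exp (ρ₄ * A * b ^ ρ₃)) := by
  have hb0 : 0 ≤ b := zero_le_one.trans hb
  -- `A^j ≤ j!·e^{A·b^p}` (`b^p ≥ 1`)
  have hAj : A ^ j ≤ (j.factorial : ℝ) * Real.exp (1 * A * b ^ p) := pow_le_factorial_mul_exp hA hb hp0 le_rfl j
  -- merge the two `A`-exponentials
  have hmerge : Real.exp (1 * A * b ^ p) * Real.exp (c₂ * A * b ^ p) = Real.exp ((c₂ + 1) * A * b ^ p) := by
    rw [← Real.exp_add]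
    congr 1
    ring
  have hmain := poly_mul_gauss_le_snd (ρ₄ := ρ₄) (A := A) (b := b) (mul_nonneg hC (Nat.cast_nonneg j.factorial)) hA hb hρ₃ hγ'
    (by linarith : 0 ≤ c₂ + 1) hc₂' hp q
  calc C * b ^ q * A ^ j * Real.exp (c₂ * A * b ^ p) * Real.exp (-((γ' * b) ^ 2 / 4))
      ≤ C * b ^ q * ((j.factorial : ℝ) * Real.exp (1 * A * b ^ p)) * Real.exp (c₂ * A * b ^ p) * Real.exp (-((γ' * b) ^ 2 / 4)) := by
        gcongr
    _ = C * j.factorial * b ^ q * (Real.exp (1 * A * b ^ p) * Real.exp (c₂ * A * b ^ p)) * Real.exp (-((γ' * b) ^ 2 / 4)) := by ring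
    _ = C * j.factorial * b ^ q * Real.exp ((c₂ + 1) * A * b ^ p) * Real.exp (-((γ' * b) ^ 2 / 4)) := by rw [hmerge]
    _ ≤ (C * j.factorial * q.factorial * Real.exp (27 / 4 * ((ρ₃ + 1) / γ' ^ (3 / 2 : ℝ)) ^ 4)) *
          (Real.exp (-(ρ₃ * b ^ (3 / 2 : ℝ))) * Real.exp (ρ₄ * A * b ^ ρ₃)) := hmain
    _ = _ := by ring

/-- **SHAPE (iii) carrying `A^j`, no `A`-exponential**: `C·b^q·A^j·e^{−(γ′b)²/4} ≤ (C·q!·j!·e^{27ρ⁴/4})·e^{−ρ₃b^{3/2}}e^{ρ₄Ab^{ρ₃}}`, `ρ = (ρ₃+1)/γ′^{3/2}`,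
for `0 < γ′`, `b ≥ 1`, `A, C ≥ 0`, `ρ₃ ≥ 0`, `ρ₄ ≥ 1` (the `χ → 1` constant `cχ` of (5.29)). [cite: BenfattoEtAl1978, (5.29) p.157, (C.9) p.165, (4.7) p.152] -/
theorem gauss_atom_le_snd' {C γ' : ℝ} (hC : 0 ≤ C) (hA : 0 ≤ A) (hb : 1 ≤ b) (hρ₃ : 0 ≤ ρ₃) (hγ' : 0 < γ') (hρ₄ : 1 ≤ ρ₄) (q j : ℕ) :
    C * b ^ q * A ^ j * Real.exp (-((γ' * b) ^ 2 / 4)) ≤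
      (C * q.factorial * j.factorial * Real.exp (27 / 4 * ((ρ₃ + 1) / γ' ^ (3 / 2 : ℝ)) ^ 4)) *
        (Real.exp (-(ρ₃ * b ^ (3 / 2 : ℝ))) * Real.exp (ρ₄ * A * b ^ ρ₃)) := by
  have h := gauss_atom_le_snd (ρ₄ := ρ₄) (c₂ := 0) (p := 0) hC hA hb hρ₃ hγ' le_rfl hρ₃ le_rfl (by linarith) q j
  simpa only [zero_mul, Real.exp_zero, mul_one] using h

/-- `(min 1 (P·x))^r ≤ P·x^r` for `0 ≤ x`, `1 ≤ P`, `0 ≤ r ≤ 1` (`(Px)^r = P^r x^r` and `P^r ≤ P`): the fractional power `(2|□|e^{−b²/4})^{1/(2k)}` of the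
`χ → 1` term of (5.29) keeps the volume factor `2|□|` whole and takes the root of the Gaussian only. [cite: BenfattoEtAl1978, (5.29) p.157, (C.9) p.165] -/
theorem min_one_mul_rpow_le {P x r : ℝ} (hx : 0 ≤ x) (hP : 1 ≤ P) (hr0 : 0 ≤ r) (hr1 : r ≤ 1) :
    (min 1 (P * x)) ^ r ≤ P * x ^ r := by
  have hP0 : 0 ≤ P := zero_le_one.trans hP
  have hmin0 : 0 ≤ min 1 (P * x) := le_min zero_le_one (mul_nonneg hP0 hx)
  calc (min 1 (P * x)) ^ r ≤ (P * x) ^ r := Real.rpow_le_rpow hmin0 (min_le_right _ _) hr0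
    _ = P ^ r * x ^ r := Real.mul_rpow hP0 hx
    _ ≤ P * x ^ r := by
        refine mul_le_mul_of_nonneg_right ?_ (Real.rpow_nonneg hx _)
        calc P ^ r ≤ P ^ (1 : ℝ) := Real.rpow_le_rpow_of_exponent_le hP hr1
          _ = P := Real.rpow_one P

/-- **The root of the Gaussian at a cut-off `c ≥ γ′b` is a Gaussian at `√r·γ′b`**: `(e^{−c²/4})^r ≤ e^{−(√r·γ′·b)²/4}` for `0 ≤ r`, `0 ≤ γ′b ≤ c`.
[cite: BenfattoEtAl1978, (5.29) p.157, (5.19) p.156] -/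
theorem exp_neg_rpow_cutoff_le {c γ' b r : ℝ} (hr : 0 ≤ r) (hγb : 0 ≤ γ' * b) (hc : γ' * b ≤ c) :
    Real.exp (-(c ^ 2 / 4)) ^ r ≤ Real.exp (-((Real.sqrt r * γ' * b) ^ 2 / 4)) := by
  rw [← Real.exp_mul, Real.exp_le_exp]
  have hsq : (γ' * b) ^ 2 ≤ c ^ 2 := pow_le_pow_left₀ hγb hc 2
  have hr2 : Real.sqrt r ^ 2 = r := Real.sq_sqrt hr
  have : (Real.sqrt r * γ' * b) ^ 2 = r * (γ' * b) ^ 2 := by rw [mul_assoc, mul_pow, hr2]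
  rw [this]
  nlinarith

/-- **A Gaussian at any cut-off `c ≥ γ′b` is below the Gaussian at `γ′b`**: `e^{−c²/4} ≤ e^{−(γ′b)²/4}` (`0 ≤ γ′b ≤ c`). [cite: BenfattoEtAl1978, (5.19) p.156] -/
theorem exp_neg_cutoff_sq_le {c γ' b : ℝ} (hγb : 0 ≤ γ' * b) (hc : γ' * b ≤ c) :
    Real.exp (-(c ^ 2 / 4)) ≤ Real.exp (-((γ' * b) ^ 2 / 4)) := by
  rw [Real.exp_le_exp]
  have hsq : (γ' * b) ^ 2 ≤ c ^ 2 := pow_le_pow_left₀ hγb hc 2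
  linarith

end Shapes

/-! ## §2  Print's parameters in both regimes: `L = ⌈b²⌉₊`, `v = if b₀ ≤ b then ⌈M·b^{3/2}⌉₊ else 1`, `w = 2v` -/

section Parameters

variable {b b₀ M : ℝ} {d : ℕ}

/-- `0 < ⌈b²⌉₊` for `b ≥ 1` (the `hL` of the step theorems). [cite: BenfattoEtAl1978, §5 p.154] -/
theorem natCeil_sq_pos (hb : 1 ≤ b) : 0 < ⌈b ^ 2⌉₊ :=
  Nat.ceil_pos.mpr (by nlinarith)

/-- `1 ≤ v` in both regimes (`⌈M·b^{3/2}⌉₊ ≥ 1` needs `0 < M·b^{3/2}`). [cite: BenfattoEtAl1978, §5 p.154, p.159] -/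
theorem one_le_regimeV (hM : 0 < M) (hb : 1 ≤ b) : 1 ≤ (if b₀ ≤ b then ⌈M * b ^ (3 / 2 : ℝ)⌉₊ else 1) := by
  split_ifs with h
  · exact Nat.one_le_iff_ne_zero.mpr (Nat.ceil_pos.mpr (mul_pos hM (Real.rpow_pos_of_pos (by linarith) _))).ne'
  · exact le_rfl

/-- `v ≤ w = 2v` and `1 ≤ w` (the `hv`/`hw` of the step theorems) for any `v ≥ 1`. [cite: BenfattoEtAl1978, §5 p.154] -/
theorem le_two_mul_and_one_le {v : ℕ} (hv : 1 ≤ v) : v ≤ 2 * v ∧ 1 ≤ 2 * v := by omega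

/-- **The wide regime has wide corridors**: `b₀ ≤ b → M·b^{3/2} ≤ v` (the `hreg` of `decay_atom_le_snd`; Mathlib's `Nat.le_ceil`).
[cite: BenfattoEtAl1978, §5 p.159] -/
theorem wide_of_regime (h : b₀ ≤ b) : M * b ^ (3 / 2 : ℝ) ≤ ((if b₀ ≤ b then ⌈M * b ^ (3 / 2 : ℝ)⌉₊ else 1 : ℕ) : ℝ) := by
  rw [if_pos h]
  exact Nat.le_ceil _

/-- `X ≤ Y` in `ℕ` transfers the wide-corridor hypothesis: `b₀ ≤ b → M·b^{3/2} ≤ v` and `v ≤ X` give `b₀ ≤ b → M·b^{3/2} ≤ X` (for `X = w`, `w + v + 1`, …).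
[cite: BenfattoEtAl1978, §5 p.159] -/
theorem wide_mono {v X : ℕ} (hreg : b₀ ≤ b → M * b ^ (3 / 2 : ℝ) ≤ (v : ℝ)) (hvX : v ≤ X) : b₀ ≤ b → M * b ^ (3 / 2 : ℝ) ≤ (X : ℝ) :=
  fun h => (hreg h).trans (by exact_mod_cast hvX)

/-- **THE DISPLACED PAVEMENTS FIT IN BOTH REGIMES**: with `L = ⌈b²⌉₊`, `v` as above and `w = 2v`, `(d+1)·2(2w+v) ≤ L` as soon as `10(d+1) ≤ b²`
(bounded regime, `v = 1`) and `(10(d+1)(M+1))² ≤ b₀` (so that the wide regime `b ≥ b₀` is inside `…ErrTermLedger.shifts_fit`), `M ≥ 0`.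
[cite: BenfattoEtAl1978, §5 p.154 «we can arrange the pavements», p.159 «displaced by b²/2»] -/
theorem shifts_fit_regime (hM : 0 ≤ M) (hb₀ : (10 * ((d : ℝ) + 1) * (M + 1)) ^ 2 ≤ b₀) (hb : 10 * ((d : ℝ) + 1) ≤ b ^ 2) :
    (d + 1) * (2 * (2 * (2 * (if b₀ ≤ b then ⌈M * b ^ (3 / 2 : ℝ)⌉₊ else 1)) + (if b₀ ≤ b then ⌈M * b ^ (3 / 2 : ℝ)⌉₊ else 1))) ≤ ⌈b ^ 2⌉₊ := by
  split_ifs with h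
  · exact shifts_fit hM (hb₀.trans h)
  · have h10 : (d + 1) * (2 * (2 * (2 * 1) + 1)) = (d + 1) * 10 := by norm_num
    rw [h10]
    have hreal : (((d + 1) * 10 : ℕ) : ℝ) ≤ (⌈b ^ 2⌉₊ : ℝ) := by
      push_cast
      nlinarith [sq_le_natCeil_sq b]
    exact_mod_cast hreal

/-- From the fit `(d+1)·c ≤ L` with `d ≥ 1` and `c ≥ 1`: `c < L` (the `hL2 : 2(2w+v) < L` of the step theorems, `c = 2(2w+v)`).
[cite: BenfattoEtAl1978, §5 p.154] -/
theorem lt_of_succ_mul_le {c L : ℕ} (hd : 0 < d) (hc : 0 < c) (h : (d + 1) * c ≤ L) : c < L := by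
  have : 2 * c ≤ (d + 1) * c := Nat.mul_le_mul_right c (by omega)
  omega

/-- kernel: `x^{n}/n! ≤ e^{x}` for `x ≥ 0` gives `n!·y ≤ x^n → y ≤ e^x`-type comparisons; here: `6·P ≤ e^{x}` from `6·P·n! ≤ x^n`. [folklore] -/
private theorem six_mul_le_exp_of_pow {P x : ℝ} {n : ℕ} (hx : 0 ≤ x) (h : 6 * P * n.factorial ≤ x ^ n) : 6 * P ≤ Real.exp x := by
  have h1 : x ^ n / (n.factorial : ℝ) ≤ Real.exp x := Real.pow_div_factorial_le_exp x hx n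
  have hn : (0 : ℝ) < n.factorial := by exact_mod_cast Nat.factorial_pos n
  rw [div_le_iff₀ hn] at h1
  nlinarith

/-- **THE SMALL-FIELD VOLUME HYPOTHESIS HOLDS FROM A FREE-FIELD THRESHOLD**: with `L = ⌈b²⌉₊`, at every cut-off `c ≥ γ′·b` (`γ′ > 0`),
`L^d·e^{−c²/4} ≤ 1/6` as soon as `6·2^d·(d+1)!·(4/γ′²)^{d+1} ≤ b²` and `b ≥ 1` — since `e^{(γ′b)²/4} ≥ ((γ′b)²/4)^{d+1}/(d+1)! ≥ 6·(2b²)^d`.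
This is the `hsmall` of `…Sect5StepBound.exists_lower_step`/`exists_upper_step` at the cut-offs `γ^k b` (`γ′ = γ^{d}`) resp. `b/γ^{k+1}` (`γ′ = 1`).
[cite: BenfattoEtAl1978, (5.19)–(5.20) p.156, p.159] -/
theorem natCeil_sq_pow_mul_exp_le {c γ' : ℝ} (hγ' : 0 < γ') (hb : 1 ≤ b) (hγc : γ' * b ≤ c)
    (hthr : 6 * 2 ^ d * ((d + 1).factorial : ℝ) * (4 / γ' ^ 2) ^ (d + 1) ≤ b ^ 2) :
    ((⌈b ^ 2⌉₊ : ℕ) : ℝ) ^ d * Real.exp (-(c ^ 2 / 4)) ≤ 1 / 6 := by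
  have hb0 : 0 ≤ b := zero_le_one.trans hb
  have hγb : 0 ≤ γ' * b := mul_nonneg hγ'.le hb0
  have hL : ((⌈b ^ 2⌉₊ : ℕ) : ℝ) ≤ 2 * b ^ 2 := natCeil_sq_le_two_mul_sq hb
  have hL0 : 0 ≤ ((⌈b ^ 2⌉₊ : ℕ) : ℝ) := Nat.cast_nonneg _
  -- reduce to the cut-off `γ′b`
  have hcut : Real.exp (-(c ^ 2 / 4)) ≤ Real.exp (-((γ' * b) ^ 2 / 4)) := exp_neg_cutoff_sq_le hγb hγc
  -- `6·(2b²)^d ≤ e^{(γ′b)²/4}`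
  set x : ℝ := (γ' * b) ^ 2 / 4 with hxdef
  have hx0 : 0 ≤ x := by positivity
  have hγ2 : 0 < γ' ^ 2 := pow_pos hγ' 2
  have hkey : 6 * (2 * b ^ 2) ^ d ≤ Real.exp x := by
    refine six_mul_le_exp_of_pow (n := d + 1) hx0 ?_
    -- `6·(2b²)^d·(d+1)! ≤ ((γ′b)²/4)^{d+1}` ⇔ `6·2^d·(d+1)!·(4/γ′²)^{d+1}·b^{2d} ≤ b^{2d+2}`
    have hxpow : x ^ (d + 1) = (γ' ^ 2 / 4) ^ (d + 1) * (b ^ 2) ^ d * b ^ 2 := by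
      rw [hxdef]
      ring
    rw [hxpow]
    have h4 : (4 / γ' ^ 2) ^ (d + 1) * (γ' ^ 2 / 4) ^ (d + 1) = 1 := by
      rw [← mul_pow]
      have : 4 / γ' ^ 2 * (γ' ^ 2 / 4) = 1 := by field_simp
      rw [this, one_pow]
    have hb2d : 0 ≤ (b ^ 2) ^ d := by positivity
    have hq0 : 0 ≤ (γ' ^ 2 / 4) ^ (d + 1) := by positivity
    calc 6 * (2 * b ^ 2) ^ d * ((d + 1).factorial : ℝ)
        = (6 * 2 ^ d * ((d + 1).factorial : ℝ) * (4 / γ' ^ 2) ^ (d + 1)) * ((γ' ^ 2 / 4) ^ (d + 1)) * (b ^ 2) ^ d := by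
          rw [mul_pow]
          have : 6 * (2 ^ d * (b ^ 2) ^ d) * ((d + 1).factorial : ℝ) =
              6 * 2 ^ d * ((d + 1).factorial : ℝ) * ((4 / γ' ^ 2) ^ (d + 1) * (γ' ^ 2 / 4) ^ (d + 1)) * (b ^ 2) ^ d := by
            rw [h4]; ring
          rw [this]; ring
      _ ≤ b ^ 2 * ((γ' ^ 2 / 4) ^ (d + 1)) * (b ^ 2) ^ d := by gcongr
      _ = (γ' ^ 2 / 4) ^ (d + 1) * (b ^ 2) ^ d * b ^ 2 := by ring
  have hexp : Real.exp (-((γ' * b) ^ 2 / 4)) = (Real.exp x)⁻¹ := by rw [hxdef, Real.exp_neg]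
  have hex0 : 0 < Real.exp x := Real.exp_pos x
  calc ((⌈b ^ 2⌉₊ : ℕ) : ℝ) ^ d * Real.exp (-(c ^ 2 / 4))
      ≤ (2 * b ^ 2) ^ d * Real.exp (-((γ' * b) ^ 2 / 4)) := by gcongr
    _ = (2 * b ^ 2) ^ d * (Real.exp x)⁻¹ := by rw [hexp]
    _ ≤ 1 / 6 := by
        rw [← div_eq_mul_inv, div_le_div_iff₀ hex0 (by norm_num : (0 : ℝ) < 6)]
        linarith

/-- **Far conditioning**: `√d·(L − 1) < b³` for `L = ⌈b²⌉₊` and `b > 2√d`, `b ≥ 1` (the `hR` of `…PavementChainUpper.disjoint_union_corridors_shrink_of_far`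
at print's distance `R = b³` between `C` and `J`). [cite: BenfattoEtAl1978, Lemma p.152 «C at distance b³ from J», §5 p.154] -/
theorem sqrt_mul_natCeil_sq_lt_cube (hb : 1 ≤ b) (hfar : 2 * Real.sqrt d < b) :
    Real.sqrt d * (((⌈b ^ 2⌉₊ : ℕ) : ℝ) - 1) < b ^ 3 := by
  have hb0 : 0 < b := by linarith
  have hL : ((⌈b ^ 2⌉₊ : ℕ) : ℝ) ≤ 2 * b ^ 2 := natCeil_sq_le_two_mul_sq hb
  have hd0 : 0 ≤ Real.sqrt d := Real.sqrt_nonneg _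
  have hb2 : 0 < b ^ 2 := by positivity
  calc Real.sqrt d * (((⌈b ^ 2⌉₊ : ℕ) : ℝ) - 1) ≤ Real.sqrt d * (2 * b ^ 2) := by
        refine mul_le_mul_of_nonneg_left ?_ hd0
        linarith
    _ = (2 * Real.sqrt d) * b ^ 2 := by ring
    _ < b * b ^ 2 := mul_lt_mul_of_pos_right hfar hb2
    _ = b ^ 3 := by ring

/-- **The Appendix-A threshold at the last cut-off**: `b̄ < γⁿ·b` from `b̄/γⁿ < b` (`γ > 0`) — print's `b* ≥ γ⁻³b̄`.
[cite: BenfattoEtAl1978, p.159 «b* = max{10⁴, γ⁻³b̄}», Appendix A p.161] -/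
theorem lt_pow_mul_of_div_lt {γ bbar : ℝ} {n : ℕ} (hγ : 0 < γ) (h : bbar / γ ^ n < b) : bbar < γ ^ n * b := by
  have hγn : 0 < γ ^ n := pow_pos hγ n
  rwa [div_lt_iff₀ hγn, mul_comm] at h

end Parameters

/-! ## §3  Normal forms: every factor of the per-step losses is `≤ const·b^{q}·A^{j}` at a cut-off `1 ≤ c ≤ Γ·b`, `L ≤ 2b²` -/

section NormalForms

variable {A b c Γ : ℝ} {L : ℕ} {d D : ℕ}

/-- A cut-off `0 ≤ c ≤ Γ·b` has `c^D ≤ Γ^D·b^D`. [cite: BenfattoEtAl1978, §5 p.159 «b replaced by γb»] -/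
theorem cutoff_pow_le (hc : 0 ≤ c) (hcb : c ≤ Γ * b) (D : ℕ) : c ^ D ≤ Γ ^ D * b ^ D := by
  rw [← mul_pow]
  exact pow_le_pow_left₀ hc hcb D

/-- Tesserae of side `L ≤ 2b²` have `L^d ≤ 2^d·b^{2d}`. [cite: BenfattoEtAl1978, §5 p.154, p.159] -/
theorem side_pow_le (hL : ((L : ℕ) : ℝ) ≤ 2 * b ^ 2) (d : ℕ) : ((L : ℕ) : ℝ) ^ d ≤ 2 ^ d * b ^ (2 * d) := by
  rw [pow_mul, ← mul_pow]
  exact pow_le_pow_left₀ (Nat.cast_nonneg L) hL d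

/-- `c^D·L^d ≤ (Γ^D·2^d)·b^{D+2d}` for a cut-off `0 ≤ c ≤ Γ·b` and a side `L ≤ 2b²` (`Γ, b ≥ 0`). [cite: BenfattoEtAl1978, §5 p.159] -/
theorem cutoff_pow_mul_side_pow_le (hb : 0 ≤ b) (hΓ : 0 ≤ Γ) (hc : 0 ≤ c) (hcb : c ≤ Γ * b) (hL : ((L : ℕ) : ℝ) ≤ 2 * b ^ 2) (D d : ℕ) :
    c ^ D * ((L : ℕ) : ℝ) ^ d ≤ (Γ ^ D * 2 ^ d) * b ^ (D + 2 * d) := by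
  have h1 := cutoff_pow_le hc hcb D
  have h2 := side_pow_le hL d
  calc c ^ D * ((L : ℕ) : ℝ) ^ d ≤ (Γ ^ D * b ^ D) * (2 ^ d * b ^ (2 * d)) := by gcongr
    _ = (Γ ^ D * 2 ^ d) * b ^ (D + 2 * d) := by ring

/-- The geometric factor `2/(1 − e^{−x})·e^{x}` is `≥ 0` for `x ≥ 0` (for `x = 0` Lean's `2/0 = 0`). [folklore] -/
private theorem geom_nonneg {x : ℝ} (hx : 0 ≤ x) : 0 ≤ 2 / (1 - Real.exp (-x)) * Real.exp x := by
  refine mul_nonneg (div_nonneg (by norm_num) ?_) (Real.exp_pos _).le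
  have : Real.exp (-x) ≤ 1 := Real.exp_le_one_iff.mpr (by linarith)
  linarith

/-- **The combinatorial mass sums are `≥ 0` and uniform in `s`**: for a rate `X ≥ 0`,
`0 ≤ Σ_{p≤s}#adm(p,D)·((2/(1−e^{−X/p/√d}))e^{X/p/√d})^{d(p−1)} ≤ Σ_{p≤D}(same)`. [cite: BenfattoEtAl1978, (4.5) p.152, (5.11) p.155] -/
theorem sum_adm_geom_nonneg_le {X : ℝ} (hX : 0 ≤ X) (s D d : ℕ) :
    0 ≤ ∑ p ∈ Finset.Icc 1 s, ((admissible p D).card : ℝ) *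
        ((2 / (1 - Real.exp (-(X / (p : ℕ) / Real.sqrt d))) * Real.exp (X / (p : ℕ) / Real.sqrt d)) ^ d) ^ (p - 1) ∧
    ∑ p ∈ Finset.Icc 1 s, ((admissible p D).card : ℝ) *
        ((2 / (1 - Real.exp (-(X / (p : ℕ) / Real.sqrt d))) * Real.exp (X / (p : ℕ) / Real.sqrt d)) ^ d) ^ (p - 1) ≤
    ∑ p ∈ Finset.Icc 1 D, ((admissible p D).card : ℝ) *
        ((2 / (1 - Real.exp (-(X / (p : ℕ) / Real.sqrt d))) * Real.exp (X / (p : ℕ) / Real.sqrt d)) ^ d) ^ (p - 1) := by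
  have hf : ∀ p : ℕ, 0 ≤ ((2 / (1 - Real.exp (-(X / (p : ℕ) / Real.sqrt d))) * Real.exp (X / (p : ℕ) / Real.sqrt d)) ^ d) ^ (p - 1) :=
    fun p => pow_nonneg (pow_nonneg (geom_nonneg (by positivity)) d) _
  exact ⟨Finset.sum_nonneg fun p _ => mul_nonneg (Nat.cast_nonneg _) (hf p),
    sum_card_admissible_mul_le s D _ hf⟩

/-- **`K = 4s₁Ac^{D}L^{d}` in normal form**: `K ≤ (4·s₁(D)·Γ^D·2^d)·(A·b^{D+2d})` at a cut-off `0 ≤ c ≤ Γ·b`, side `L ≤ 2b²`, `A ≥ 0`, `ϰ ≥ 0`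
(`s₁(s) ≤ s₁(D)` is `…ErrTermLedger.s1Const_le`). [cite: BenfattoEtAl1978, (5.15) p.155, (5.21) p.156] -/
theorem K_le {s : ℕ} {κ : ℝ} (hκ : 0 ≤ κ) (hA : 0 ≤ A) (hb : 0 ≤ b) (hΓ : 0 ≤ Γ) (hc : 0 ≤ c) (hcb : c ≤ Γ * b) (hL : ((L : ℕ) : ℝ) ≤ 2 * b ^ 2) :
    4 * (s1Const s D d κ * A * c ^ D * ((L : ℕ) : ℝ) ^ d) ≤ (4 * s1Const D D d κ * Γ ^ D * 2 ^ d) * (A * b ^ (D + 2 * d)) := by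
  have h1 := cutoff_pow_mul_side_pow_le hb hΓ hc hcb hL D d
  have hs := s1Const_le s D d hκ
  have hs0 := s1Const_nonneg D D d hκ
  calc 4 * (s1Const s D d κ * A * c ^ D * ((L : ℕ) : ℝ) ^ d) = 4 * (s1Const s D d κ * A * (c ^ D * ((L : ℕ) : ℝ) ^ d)) := by ring
    _ ≤ 4 * (s1Const D D d κ * A * ((Γ ^ D * 2 ^ d) * b ^ (D + 2 * d))) := by gcongr
    _ = _ := by ring

/-- **`(1 + (1+2d/α²)·(γc))^D` in normal form**: `≤ ((2+2d/α²)·Γ)^D·b^D` for `0 ≤ γ ≤ 1`, `0 ≤ c ≤ Γb`, `1 ≤ Γb` (the `(1 + |u|/…)`-factor of the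
`χ → 1` constant `cχ`). [cite: BenfattoEtAl1978, (5.29) p.157, (C.8) p.165] -/
theorem one_add_cutoff_pow_le {α γ : ℝ} (hγ0 : 0 ≤ γ) (hγ1 : γ ≤ 1) (hc : 0 ≤ c) (hcb : c ≤ Γ * b) (hΓb : 1 ≤ Γ * b) (D : ℕ) :
    (1 + (1 + 2 * d / α ^ 2) * (γ * c)) ^ D ≤ ((2 + 2 * d / α ^ 2) * Γ) ^ D * b ^ D := by
  rw [← mul_pow]
  refine pow_le_pow_left₀ (by positivity) ?_ D
  have hγc : γ * c ≤ Γ * b := (mul_le_of_le_one_left hc hγ1).trans hcb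
  have hq : 0 ≤ 2 * (d : ℝ) / α ^ 2 := by positivity
  nlinarith [mul_le_mul_of_nonneg_left hγc (by positivity : (0 : ℝ) ≤ 1 + 2 * d / α ^ 2)]

/-- **`K₀ = max(max 1 C₀₀, (1+2d/α²)·(γc))` in normal form**: `K₀ ≤ (max 1 C₀₀ + (1+2d/α²)·Γ)·b` (`b ≥ 1`, `γ ≤ 1`, `0 ≤ c ≤ Γb`).
[cite: BenfattoEtAl1978, Appendix D p.165, (C.8) p.165] -/
theorem K0_le {α γ C00 : ℝ} (hb : 1 ≤ b) (hγ1 : γ ≤ 1) (hc : 0 ≤ c) (hcb : c ≤ Γ * b) :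
    max (max 1 C00) ((1 + 2 * d / α ^ 2) * (γ * c)) ≤ (max 1 C00 + (1 + 2 * d / α ^ 2) * Γ) * b := by
  have hγc : γ * c ≤ Γ * b := (mul_le_of_le_one_left hc hγ1).trans hcb
  have hq : 0 ≤ 1 + 2 * (d : ℝ) / α ^ 2 := by positivity
  have hm : 0 ≤ max 1 C00 := le_max_of_le_left zero_le_one
  refine max_le ?_ ?_
  · calc max 1 C00 = max 1 C00 * 1 := (mul_one _).symm
      _ ≤ max 1 C00 * b := mul_le_mul_of_nonneg_left hb hm
      _ ≤ (max 1 C00 + (1 + 2 * d / α ^ 2) * Γ) * b := by nlinarith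
  · calc (1 + 2 * d / α ^ 2) * (γ * c) ≤ (1 + 2 * d / α ^ 2) * (Γ * b) := mul_le_mul_of_nonneg_left hγc hq
      _ ≤ (max 1 C00 + (1 + 2 * d / α ^ 2) * Γ) * b := by nlinarith

end NormalForms

/-! ## §4  The per-box error `ErrPB` of `…Sect5PerBoxErrBound.perBoxErr_le` at a cut-off `c`, atom by atom -/

section ErrPBAtoms

variable {α β : ℝ} {s D d t : ℕ} {κ A b c Γ γ γ' δ ρ₁ ρ₂ ρ₃ ρ₄ b₀ M : ℝ} {L w v : ℕ}

/-- `u = s₁(s)·A·c^D·L^d ≤ (s₁(D)·Γ^D·2^d)·(A·b^{D+2d})` (the unit of `K = 4u` and of `ε = u·e^{−ϰv/4}`). [cite: BenfattoEtAl1978, (5.15) p.155, (5.24) p.157] -/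
theorem unitK_le (hκ : 0 ≤ κ) (hA : 0 ≤ A) (hb : 0 ≤ b) (hΓ : 0 ≤ Γ) (hc : 0 ≤ c) (hcb : c ≤ Γ * b) (hL : ((L : ℕ) : ℝ) ≤ 2 * b ^ 2) :
    s1Const s D d κ * A * c ^ D * ((L : ℕ) : ℝ) ^ d ≤ (s1Const D D d κ * Γ ^ D * 2 ^ d) * (A * b ^ (D + 2 * d)) := by
  have h := K_le (s := s) (D := D) (d := d) hκ hA hb hΓ hc hcb hL
  linarith

/-- **ATOM (g) — the `(t+1)`-st order remainder `2·2^{C(t+1,2)}K^{t+1}/(t+1)!` of (5.21)/(5.33) fits the FIRST summand**: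
`≤ (2·2^{C(t+1,2)}/(t+1)!·(4s₁(D)Γ^D2^d)^{t+1})·(A·b^{ρ₁}·e^{ρ₂Ab^{ρ₃}})^{t+1}` for `D + 2d ≤ ρ₁`, `ρ₂ ≥ 0`, `b ≥ 1`, cut-off `0 ≤ c ≤ Γb`, `L ≤ 2b²`.
[cite: BenfattoEtAl1978, (5.21) p.156, (5.33) p.158, (4.7) p.152] -/
theorem errPB_remainder_le (hκ : 0 ≤ κ) (hA : 0 ≤ A) (hb : 1 ≤ b) (hΓ : 0 ≤ Γ) (hc : 0 ≤ c) (hcb : c ≤ Γ * b) (hL : ((L : ℕ) : ℝ) ≤ 2 * b ^ 2)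
    (hρ₁ : (D : ℝ) + 2 * d ≤ ρ₁) (hρ₂ : 0 ≤ ρ₂) :
    2 * (2 ^ ((t + 1).choose 2) * (4 * (s1Const s D d κ * A * c ^ D * ((L : ℕ) : ℝ) ^ d)) ^ (t + 1) / (t + 1)!) ≤
      (2 * 2 ^ ((t + 1).choose 2) / (t + 1)! * (4 * s1Const D D d κ * Γ ^ D * 2 ^ d) ^ (t + 1)) *
        (A * b ^ ρ₁ * Real.exp (ρ₂ * A * b ^ ρ₃)) ^ (t + 1) := by
  have hb0 : 0 ≤ b := zero_le_one.trans hb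
  have hK := K_le (s := s) (D := D) (d := d) hκ hA hb0 hΓ hc hcb hL
  have hK0 : 0 ≤ 4 * (s1Const s D d κ * A * c ^ D * ((L : ℕ) : ℝ) ^ d) := by
    have := s1Const_nonneg s D d hκ
    positivity
  have hC0 : 0 ≤ 2 * 2 ^ ((t + 1).choose 2) / ((t + 1)! : ℝ) * (4 * s1Const D D d κ * Γ ^ D * 2 ^ d) ^ (t + 1) := by
    have := s1Const_nonneg D D d hκ
    positivity
  -- the power in real-exponent form
  have hp : A * b ^ (D + 2 * d) = A * b ^ (((D + 2 * d : ℕ) : ℝ)) := by rw [Real.rpow_natCast]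
  have hpρ : (((D + 2 * d : ℕ) : ℝ)) ≤ ρ₁ := by push_cast; exact hρ₁
  calc 2 * (2 ^ ((t + 1).choose 2) * (4 * (s1Const s D d κ * A * c ^ D * ((L : ℕ) : ℝ) ^ d)) ^ (t + 1) / (t + 1)!)
      ≤ 2 * (2 ^ ((t + 1).choose 2) * ((4 * s1Const D D d κ * Γ ^ D * 2 ^ d) * (A * b ^ (D + 2 * d))) ^ (t + 1) / (t + 1)!) := by
        gcongr
    _ = (2 * 2 ^ ((t + 1).choose 2) / (t + 1)! * (4 * s1Const D D d κ * Γ ^ D * 2 ^ d) ^ (t + 1)) *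
          (A * b ^ (((D + 2 * d : ℕ) : ℝ))) ^ (t + 1) := by rw [← hp]; ring
    _ ≤ _ := remainder_le_fst hC0 hA hb hpρ hρ₂ t

/-- **ATOM (h) — the small-field volume `e^{2K}·3|□|e^{−c²/4}` of (5.19)/(5.20) fits the SECOND summand**: with `c₂ := 8s₁(D)Γ^D2^d ≤ ρ₄`,
`D + 2d ≤ ρ₃`, at a cut-off `γ′b ≤ c ≤ Γb` (`γ′ > 0`), `L ≤ 2b²`, `b ≥ 1`:
`e^{2K}·3L^de^{−c²/4} ≤ (3·2^d·(2d)!·e^{27ρ⁴/4})·e^{−ρ₃b^{3/2}}e^{ρ₄Ab^{ρ₃}}`, `ρ = (ρ₃+1)/γ′^{3/2}`. [cite: BenfattoEtAl1978, (5.19)–(5.20) p.156, (4.7) p.152] -/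
theorem errPB_volume_le (hκ : 0 ≤ κ) (hA : 0 ≤ A) (hb : 1 ≤ b) (hΓ : 0 ≤ Γ) (hc : 0 ≤ c) (hcb : c ≤ Γ * b) (hL : ((L : ℕ) : ℝ) ≤ 2 * b ^ 2)
    (hγ' : 0 < γ') (hγc : γ' * b ≤ c) (hρ₃ : (D : ℝ) + 2 * d ≤ ρ₃) (hρ₄ : 8 * s1Const D D d κ * Γ ^ D * 2 ^ d ≤ ρ₄) :
    Real.exp (2 * (4 * (s1Const s D d κ * A * c ^ D * ((L : ℕ) : ℝ) ^ d))) * (3 * (((L : ℕ) : ℝ) ^ d * Real.exp (-(c ^ 2 / 4)))) ≤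
      (3 * 2 ^ d * (2 * d).factorial * Real.exp (27 / 4 * ((ρ₃ + 1) / γ' ^ (3 / 2 : ℝ)) ^ 4)) *
        (Real.exp (-(ρ₃ * b ^ (3 / 2 : ℝ))) * Real.exp (ρ₄ * A * b ^ ρ₃)) := by
  have hb0 : 0 ≤ b := zero_le_one.trans hb
  have hγb : 0 ≤ γ' * b := mul_nonneg hγ'.le hb0
  have hs0 := s1Const_nonneg D D d hκ
  have hρ₃0 : 0 ≤ ρ₃ := le_trans (by positivity) hρ₃
  have hK := K_le (s := s) (D := D) (d := d) hκ hA hb0 hΓ hc hcb hL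
  -- `e^{2K} ≤ e^{c₂·A·b^{D+2d}}`
  have hp : b ^ (D + 2 * d) = b ^ (((D + 2 * d : ℕ) : ℝ)) := by rw [Real.rpow_natCast]
  have hpρ : (((D + 2 * d : ℕ) : ℝ)) ≤ ρ₃ := by push_cast; exact hρ₃
  have hexp : Real.exp (2 * (4 * (s1Const s D d κ * A * c ^ D * ((L : ℕ) : ℝ) ^ d))) ≤
      Real.exp ((8 * s1Const D D d κ * Γ ^ D * 2 ^ d) * A * b ^ (((D + 2 * d : ℕ) : ℝ))) := by
    rw [Real.exp_le_exp, ← hp]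
    nlinarith
  have hvol : 3 * (((L : ℕ) : ℝ) ^ d * Real.exp (-(c ^ 2 / 4))) ≤ (3 * 2 ^ d) * b ^ (2 * d) * Real.exp (-((γ' * b) ^ 2 / 4)) := by
    have h1 := side_pow_le hL d
    have h2 := exp_neg_cutoff_sq_le hγb hγc
    calc 3 * (((L : ℕ) : ℝ) ^ d * Real.exp (-(c ^ 2 / 4))) ≤ 3 * ((2 ^ d * b ^ (2 * d)) * Real.exp (-((γ' * b) ^ 2 / 4))) := by gcongr
      _ = _ := by ring
  have hmain := poly_mul_gauss_le_snd (A := A) (b := b) (ρ₃ := ρ₃) (ρ₄ := ρ₄) (C := 3 * 2 ^ d)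
    (c₂ := 8 * s1Const D D d κ * Γ ^ D * 2 ^ d) (p := ((D + 2 * d : ℕ) : ℝ)) (γ' := γ')
    (by positivity) hA hb hρ₃0 hγ' (by positivity) hρ₄ hpρ (2 * d)
  calc Real.exp (2 * (4 * (s1Const s D d κ * A * c ^ D * ((L : ℕ) : ℝ) ^ d))) * (3 * (((L : ℕ) : ℝ) ^ d * Real.exp (-(c ^ 2 / 4))))
      ≤ Real.exp ((8 * s1Const D D d κ * Γ ^ D * 2 ^ d) * A * b ^ (((D + 2 * d : ℕ) : ℝ))) *
          ((3 * 2 ^ d) * b ^ (2 * d) * Real.exp (-((γ' * b) ^ 2 / 4))) := by gcongr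
    _ = (3 * 2 ^ d) * b ^ (2 * d) * Real.exp ((8 * s1Const D D d κ * Γ ^ D * 2 ^ d) * A * b ^ (((D + 2 * d : ℕ) : ℝ))) *
          Real.exp (-((γ' * b) ^ 2 / 4)) := by ring
    _ ≤ _ := hmain

/-- **ATOM (i1) — the cumulant remainder `3^{k+1}·(Σ_π(|π|−1)!)·ε·K^k` of (5.24)/(5.33) (`ε = u·e^{−ϰv/4}`, `K = 4u`) fits the SECOND summand in both
regimes**: with `C := 3^{k+1}(Σ_π(|π|−1)!)·4^k·(s₁(D)Γ^D2^d)^{k+1}`, `q := (D+2d)(k+1)`,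
`≤ (C·(k+1)!·(q! + b₀^q e^{ρ₃b₀^{3/2}}))·e^{−ρ₃b^{3/2}}e^{ρ₄Ab^{ρ₃}}` given `b₀ ≤ b → M·b^{3/2} ≤ v` and `ρ₃ + 1 ≤ (ϰ/4)·M`.
[cite: BenfattoEtAl1978, (5.24) p.157, (5.33) p.158, (4.7) p.152] -/
theorem errPB_eps_le (hκ : 0 ≤ κ) (hA : 0 ≤ A) (hb : 1 ≤ b) (hΓ : 0 ≤ Γ) (hc : 0 ≤ c) (hcb : c ≤ Γ * b) (hL : ((L : ℕ) : ℝ) ≤ 2 * b ^ 2)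
    (hb₀ : 0 ≤ b₀) (hρ₃ : 0 ≤ ρ₃) (hρ₄ : 1 ≤ ρ₄) (hreg : b₀ ≤ b → M * b ^ (3 / 2 : ℝ) ≤ (v : ℝ)) (hM : ρ₃ + 1 ≤ κ / 4 * M) (k : ℕ) :
    3 ^ (k + 1) * ((∑ π ∈ setPartitions (univ : Finset (Fin (k + 1))), ((π.card - 1)! : ℝ)) *
        ((s1Const s D d κ * A * c ^ D * Real.exp (-(κ / 4 * v)) * ((L : ℕ) : ℝ) ^ d) *
          (4 * (s1Const s D d κ * A * c ^ D * ((L : ℕ) : ℝ) ^ d)) ^ k)) ≤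
      ((3 ^ (k + 1) * (∑ π ∈ setPartitions (univ : Finset (Fin (k + 1))), ((π.card - 1)! : ℝ)) * 4 ^ k *
          (s1Const D D d κ * Γ ^ D * 2 ^ d) ^ (k + 1)) * (k + 1).factorial *
          (((D + 2 * d) * (k + 1)).factorial + b₀ ^ ((D + 2 * d) * (k + 1)) * Real.exp (ρ₃ * b₀ ^ (3 / 2 : ℝ)))) *
        (Real.exp (-(ρ₃ * b ^ (3 / 2 : ℝ))) * Real.exp (ρ₄ * A * b ^ ρ₃)) := by
  have hb0 : 0 ≤ b := zero_le_one.trans hb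
  have hs0 := s1Const_nonneg D D d hκ
  have hss0 := s1Const_nonneg s D d hκ
  have hu := unitK_le (s := s) (D := D) (d := d) hκ hA hb0 hΓ hc hcb hL
  have hu0 : 0 ≤ s1Const s D d κ * A * c ^ D * ((L : ℕ) : ℝ) ^ d := by positivity
  have hP0 : 0 ≤ ∑ π ∈ setPartitions (univ : Finset (Fin (k + 1))), ((π.card - 1)! : ℝ) :=
    Finset.sum_nonneg fun π _ => Nat.cast_nonneg _
  -- normal form of `ε·K^k`
  have hnf : (s1Const s D d κ * A * c ^ D * Real.exp (-(κ / 4 * v)) * ((L : ℕ) : ℝ) ^ d) *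
        (4 * (s1Const s D d κ * A * c ^ D * ((L : ℕ) : ℝ) ^ d)) ^ k ≤
      (4 ^ k * (s1Const D D d κ * Γ ^ D * 2 ^ d) ^ (k + 1)) * b ^ ((D + 2 * d) * (k + 1)) * A ^ (k + 1) * Real.exp (-(κ / 4 * v)) := by
    have hrew : (s1Const s D d κ * A * c ^ D * Real.exp (-(κ / 4 * v)) * ((L : ℕ) : ℝ) ^ d) *
          (4 * (s1Const s D d κ * A * c ^ D * ((L : ℕ) : ℝ) ^ d)) ^ k =
        4 ^ k * (s1Const s D d κ * A * c ^ D * ((L : ℕ) : ℝ) ^ d) ^ (k + 1) * Real.exp (-(κ / 4 * v)) := by ring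
    rw [hrew]
    have hpow : (s1Const s D d κ * A * c ^ D * ((L : ℕ) : ℝ) ^ d) ^ (k + 1) ≤ ((s1Const D D d κ * Γ ^ D * 2 ^ d) * (A * b ^ (D + 2 * d))) ^ (k + 1) :=
      pow_le_pow_left₀ hu0 hu _
    have hsplit : ((s1Const D D d κ * Γ ^ D * 2 ^ d) * (A * b ^ (D + 2 * d))) ^ (k + 1) =
        (s1Const D D d κ * Γ ^ D * 2 ^ d) ^ (k + 1) * b ^ ((D + 2 * d) * (k + 1)) * A ^ (k + 1) := by
      rw [mul_pow, mul_pow, ← pow_mul]; ring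
    calc 4 ^ k * (s1Const s D d κ * A * c ^ D * ((L : ℕ) : ℝ) ^ d) ^ (k + 1) * Real.exp (-(κ / 4 * v))
        ≤ 4 ^ k * (((s1Const D D d κ * Γ ^ D * 2 ^ d) * (A * b ^ (D + 2 * d))) ^ (k + 1)) * Real.exp (-(κ / 4 * v)) := by gcongr
      _ = _ := by rw [hsplit]; ring
  have hatom := decay_atom_le_snd (A := A) (b := b) (b₀ := b₀) (ρ₃ := ρ₃) (ρ₄ := ρ₄)
    (C := 3 ^ (k + 1) * (∑ π ∈ setPartitions (univ : Finset (Fin (k + 1))), ((π.card - 1)! : ℝ)) * 4 ^ k *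
      (s1Const D D d κ * Γ ^ D * 2 ^ d) ^ (k + 1)) (c := κ / 4) (X := (v : ℝ)) (M := M)
    (by positivity) hA hb hb₀ hρ₃ hρ₄ (by linarith [hκ]) (Nat.cast_nonneg v) hreg hM ((D + 2 * d) * (k + 1)) (k + 1)
  calc 3 ^ (k + 1) * ((∑ π ∈ setPartitions (univ : Finset (Fin (k + 1))), ((π.card - 1)! : ℝ)) *
        ((s1Const s D d κ * A * c ^ D * Real.exp (-(κ / 4 * v)) * ((L : ℕ) : ℝ) ^ d) *
          (4 * (s1Const s D d κ * A * c ^ D * ((L : ℕ) : ℝ) ^ d)) ^ k))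
      ≤ 3 ^ (k + 1) * ((∑ π ∈ setPartitions (univ : Finset (Fin (k + 1))), ((π.card - 1)! : ℝ)) *
        ((4 ^ k * (s1Const D D d κ * Γ ^ D * 2 ^ d) ^ (k + 1)) * b ^ ((D + 2 * d) * (k + 1)) * A ^ (k + 1) * Real.exp (-(κ / 4 * v)))) := by
        gcongr
    _ = (3 ^ (k + 1) * (∑ π ∈ setPartitions (univ : Finset (Fin (k + 1))), ((π.card - 1)! : ℝ)) * 4 ^ k *
          (s1Const D D d κ * Γ ^ D * 2 ^ d) ^ (k + 1)) * b ^ ((D + 2 * d) * (k + 1)) * A ^ (k + 1) * Real.exp (-(κ / 4 * (v : ℝ))) := by ring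
    _ ≤ _ := hatom


/-- `0 ≤ momentConst q n c` (it is `2(q+1)·(nq)!·e^{c/2}`). [cite: BenfattoEtAl1978, (2.7) p.147] -/
private theorem momentConst_nonneg (q n : ℕ) (c : NNReal) : 0 ≤ momentConst q n c := by
  unfold momentConst
  positivity

/-- **ATOM (i2) — the `χ → 1` constant `cχ(k+1)` of (5.29) (`perBox_at_pavement`'s `Err`) fits the SECOND summand**: at a cut-off `γ′b ≤ c ≤ Γb` (`1 ≤ Γb`,
`0 ≤ γ ≤ 1`, `L ≥ 1`, `L ≤ 2b²`), with `r := 1/(2(k+1))`, `γ″ := √r·γ′`, `q := 2d + (D+2d)(k+1)` and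
`C := 2^{k+1}(Σ_π(|π|−1)!)·2·2^d·(((2+2d/α²)Γ)^D·2^dΣ₁(D)·momentConst D (2(k+1)) c₀)^{k+1}`:
`cχ(k+1) ≤ (C·q!·(k+1)!·e^{27ρ⁴/4})·e^{−ρ₃b^{3/2}}e^{ρ₄Ab^{ρ₃}}`, `ρ = (ρ₃+1)/γ″^{3/2}` (`ρ₃ ≥ 0`, `ρ₄ ≥ 1`).
[cite: BenfattoEtAl1978, (5.29) p.157, (C.9) p.165, (4.7) p.152] -/
theorem errPB_chi_le {c₀ : NNReal} (hκ : 0 ≤ κ) (hA : 0 ≤ A) (hb : 1 ≤ b) (hΓ : 0 ≤ Γ) (hΓb : 1 ≤ Γ * b) (hc : 0 ≤ c) (hcb : c ≤ Γ * b)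
    (hL1 : 1 ≤ ((L : ℕ) : ℝ)) (hL : ((L : ℕ) : ℝ) ≤ 2 * b ^ 2) (hγ0 : 0 ≤ γ) (hγ1 : γ ≤ 1) (hγ' : 0 < γ') (hγc : γ' * b ≤ c)
    (hρ₃ : 0 ≤ ρ₃) (hρ₄ : 1 ≤ ρ₄) (k : ℕ) :
    2 ^ (k + 1) * ((∑ π ∈ setPartitions (univ : Finset (Fin (k + 1))), ((π.card - 1)! : ℝ)) *
        ((min 1 (2 * (((L : ℕ) : ℝ) ^ d) * Real.exp (-(c ^ 2 / 4)))) ^ ((2 * (k + 1) : ℕ) : ℝ)⁻¹ *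
          ((1 + (1 + 2 * d / α ^ 2) * (γ * c)) ^ D *
              (A * ((L : ℕ) : ℝ) ^ d * ∑ p ∈ Finset.Icc 1 s, ((admissible p D).card : ℝ) *
                ((2 / (1 - Real.exp (-(κ / 2 / (p : ℕ) / Real.sqrt d))) * Real.exp (κ / 2 / (p : ℕ) / Real.sqrt d)) ^ d) ^ (p - 1)) *
            momentConst D (2 * (k + 1)) c₀) ^ (k + 1))) ≤
      ((2 ^ (k + 1) * (∑ π ∈ setPartitions (univ : Finset (Fin (k + 1))), ((π.card - 1)! : ℝ)) * (2 * 2 ^ d) *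
          (((2 + 2 * d / α ^ 2) * Γ) ^ D * (2 ^ d * ∑ p ∈ Finset.Icc 1 D, ((admissible p D).card : ℝ) *
                ((2 / (1 - Real.exp (-(κ / 2 / (p : ℕ) / Real.sqrt d))) * Real.exp (κ / 2 / (p : ℕ) / Real.sqrt d)) ^ d) ^ (p - 1)) *
            momentConst D (2 * (k + 1)) c₀) ^ (k + 1)) *
          (2 * d + (D + 2 * d) * (k + 1)).factorial * (k + 1).factorial *
          Real.exp (27 / 4 * ((ρ₃ + 1) / (Real.sqrt (((2 * (k + 1) : ℕ) : ℝ)⁻¹) * γ') ^ (3 / 2 : ℝ)) ^ 4)) *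
        (Real.exp (-(ρ₃ * b ^ (3 / 2 : ℝ))) * Real.exp (ρ₄ * A * b ^ ρ₃)) := by
  have hb0 : 0 ≤ b := zero_le_one.trans hb
  have hγb : 0 ≤ γ' * b := mul_nonneg hγ'.le hb0
  have h2d : (0 : ℝ) ≤ (2 + 2 * d / α ^ 2) * Γ := mul_nonneg (by positivity) hΓ
  obtain ⟨hSig0, hSigle⟩ := sum_adm_geom_nonneg_le (X := κ / 2) (by linarith) s D d
  obtain ⟨hSigD0, -⟩ := sum_adm_geom_nonneg_le (X := κ / 2) (by linarith) D D d
  set Sigs := ∑ p ∈ Finset.Icc 1 s, ((admissible p D).card : ℝ) *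
      ((2 / (1 - Real.exp (-(κ / 2 / (p : ℕ) / Real.sqrt d))) * Real.exp (κ / 2 / (p : ℕ) / Real.sqrt d)) ^ d) ^ (p - 1) with hSigs
  set SigD := ∑ p ∈ Finset.Icc 1 D, ((admissible p D).card : ℝ) *
      ((2 / (1 - Real.exp (-(κ / 2 / (p : ℕ) / Real.sqrt d))) * Real.exp (κ / 2 / (p : ℕ) / Real.sqrt d)) ^ d) ^ (p - 1) with hSigD
  clear_value Sigs SigD
  set P := ∑ π ∈ setPartitions (univ : Finset (Fin (k + 1))), ((π.card - 1)! : ℝ) with hP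
  have hP0 : 0 ≤ P := Finset.sum_nonneg fun π _ => Nat.cast_nonneg _
  clear_value P
  have hmc0 := momentConst_nonneg D (2 * (k + 1)) c₀
  set r : ℝ := (((2 * (k + 1) : ℕ) : ℝ))⁻¹ with hr
  have hr0 : 0 ≤ r := inv_nonneg.mpr (Nat.cast_nonneg _)
  have hr1 : r ≤ 1 := inv_le_one_of_one_le₀ (by rw [Nat.cast_mul]; push_cast; linarith)
  clear_value r
  -- the root of the Gaussian
  have hLd1 : 1 ≤ ((L : ℕ) : ℝ) ^ d := one_le_pow₀ hL1
  have hLd := side_pow_le hL d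
  have hmin : (min 1 (2 * (((L : ℕ) : ℝ) ^ d) * Real.exp (-(c ^ 2 / 4)))) ^ r ≤
      2 * (2 ^ d * b ^ (2 * d)) * Real.exp (-((Real.sqrt r * γ' * b) ^ 2 / 4)) := by
    have h1 := min_one_mul_rpow_le (P := 2 * ((L : ℕ) : ℝ) ^ d) (x := Real.exp (-(c ^ 2 / 4))) (Real.exp_pos _).le (by linarith) hr0 hr1
    have h2 := exp_neg_rpow_cutoff_le hr0 hγb hγc
    calc (min 1 (2 * (((L : ℕ) : ℝ) ^ d) * Real.exp (-(c ^ 2 / 4)))) ^ r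
        ≤ 2 * ((L : ℕ) : ℝ) ^ d * Real.exp (-(c ^ 2 / 4)) ^ r := h1
      _ ≤ 2 * (2 ^ d * b ^ (2 * d)) * Real.exp (-((Real.sqrt r * γ' * b) ^ 2 / 4)) := by gcongr
  -- the `(1 + …γc)^D` factor and the mass
  have hf := one_add_cutoff_pow_le (d := d) (α := α) hγ0 hγ1 hc hcb hΓb D
  have hf0 : 0 ≤ (1 + (1 + 2 * d / α ^ 2) * (γ * c)) ^ D := by positivity
  have hM : A * ((L : ℕ) : ℝ) ^ d * Sigs ≤ A * (2 ^ d * b ^ (2 * d)) * SigD := by gcongr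
  have hM0 : 0 ≤ A * ((L : ℕ) : ℝ) ^ d * Sigs := by positivity
  have hprod : ((1 + (1 + 2 * d / α ^ 2) * (γ * c)) ^ D * (A * ((L : ℕ) : ℝ) ^ d * Sigs) * momentConst D (2 * (k + 1)) c₀) ^ (k + 1) ≤
      ((((2 + 2 * d / α ^ 2) * Γ) ^ D * b ^ D) * (A * (2 ^ d * b ^ (2 * d)) * SigD) * momentConst D (2 * (k + 1)) c₀) ^ (k + 1) := by
    gcongr
  have hsplit : ((((2 + 2 * d / α ^ 2) * Γ) ^ D * b ^ D) * (A * (2 ^ d * b ^ (2 * d)) * SigD) * momentConst D (2 * (k + 1)) c₀) ^ (k + 1) =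
      (((2 + 2 * d / α ^ 2) * Γ) ^ D * (2 ^ d * SigD) * momentConst D (2 * (k + 1)) c₀) ^ (k + 1) * b ^ ((D + 2 * d) * (k + 1)) * A ^ (k + 1) := by
    have : (((2 + 2 * d / α ^ 2) * Γ) ^ D * b ^ D) * (A * (2 ^ d * b ^ (2 * d)) * SigD) * momentConst D (2 * (k + 1)) c₀ =
        (((2 + 2 * d / α ^ 2) * Γ) ^ D * (2 ^ d * SigD) * momentConst D (2 * (k + 1)) c₀) * (b ^ (D + 2 * d) * A) := by ring
    rw [this]
    ring
  have hC0 : 0 ≤ 2 ^ (k + 1) * P * (2 * 2 ^ d) * (((2 + 2 * d / α ^ 2) * Γ) ^ D * (2 ^ d * SigD) * momentConst D (2 * (k + 1)) c₀) ^ (k + 1) :=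
    mul_nonneg (mul_nonneg (mul_nonneg (pow_nonneg zero_le_two _) hP0) (mul_nonneg zero_le_two (pow_nonneg zero_le_two _)))
      (pow_nonneg (mul_nonneg (mul_nonneg (pow_nonneg h2d D) (mul_nonneg (pow_nonneg zero_le_two _) hSigD0)) hmc0) _)
  have hatom := gauss_atom_le_snd' (A := A) (b := b) (ρ₃ := ρ₃) (ρ₄ := ρ₄)
    (C := 2 ^ (k + 1) * P * (2 * 2 ^ d) * (((2 + 2 * d / α ^ 2) * Γ) ^ D * (2 ^ d * SigD) * momentConst D (2 * (k + 1)) c₀) ^ (k + 1))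
    (γ' := Real.sqrt r * γ') hC0 hA hb hρ₃ (mul_pos (Real.sqrt_pos.mpr (by rw [hr]; positivity)) hγ') hρ₄ (2 * d + (D + 2 * d) * (k + 1)) (k + 1)
  calc 2 ^ (k + 1) * (P * ((min 1 (2 * (((L : ℕ) : ℝ) ^ d) * Real.exp (-(c ^ 2 / 4)))) ^ r *
          ((1 + (1 + 2 * d / α ^ 2) * (γ * c)) ^ D * (A * ((L : ℕ) : ℝ) ^ d * Sigs) * momentConst D (2 * (k + 1)) c₀) ^ (k + 1)))
      ≤ 2 ^ (k + 1) * (P * ((2 * (2 ^ d * b ^ (2 * d)) * Real.exp (-((Real.sqrt r * γ' * b) ^ 2 / 4))) *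
          ((((2 + 2 * d / α ^ 2) * Γ) ^ D * b ^ D) * (A * (2 ^ d * b ^ (2 * d)) * SigD) * momentConst D (2 * (k + 1)) c₀) ^ (k + 1))) :=
        mul_le_mul_of_nonneg_left (mul_le_mul_of_nonneg_left (mul_le_mul hmin hprod
          (pow_nonneg (mul_nonneg (mul_nonneg hf0 hM0) hmc0) _)
          (mul_nonneg (mul_nonneg zero_le_two (mul_nonneg (pow_nonneg zero_le_two _) (pow_nonneg hb0 _))) (Real.exp_pos _).le)) hP0)
          (pow_nonneg zero_le_two _)
    _ = (2 ^ (k + 1) * P * (2 * 2 ^ d) * (((2 + 2 * d / α ^ 2) * Γ) ^ D * (2 ^ d * SigD) * momentConst D (2 * (k + 1)) c₀) ^ (k + 1)) *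
          b ^ (2 * d + (D + 2 * d) * (k + 1)) * A ^ (k + 1) * Real.exp (-((Real.sqrt r * γ' * b) ^ 2 / 4)) := by
        rw [hsplit]; ring
    _ ≤ _ := hatom

/-- **ATOM (i3) — the Appendix-D constant `δ₂₉(k+1)` of (5.29) (`perBox_at_pavement`'s `Err`) fits the SECOND summand in both regimes**: with the rate
`ϰ′ = ϰ/2 − (δ/2)D²√d ≥ 0`, `κ₀ := max 1 C₀₀ + (1+2d/α²)Γ`, `q := (k+1)D + 2d(k+1)`,
`C := 2^{(k+1)D}2^{2^{(k+1)D}}κ₀^{(k+1)D}(e^{(δ/2)D²d}2^dΣ₂(D))^{k+1}`: `δ₂₉(k+1) ≤ (C·(k+1)!·(q! + b₀^q e^{ρ₃b₀^{3/2}}))·e^{−ρ₃b^{3/2}}e^{ρ₄Ab^{ρ₃}}`,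
given `b₀ ≤ b → M·b^{3/2} ≤ v`, `ρ₃ + 1 ≤ (δ/2)·M`, `δ ≥ 0`. [cite: BenfattoEtAl1978, (5.29) p.157, Appendix D p.165, (4.7) p.152] -/
theorem errPB_d29_le {C00 : ℝ} (hA : 0 ≤ A) (hb : 1 ≤ b) (hΓ : 0 ≤ Γ) (hc : 0 ≤ c) (hcb : c ≤ Γ * b) (hL : ((L : ℕ) : ℝ) ≤ 2 * b ^ 2)
    (hγ1 : γ ≤ 1) (hδ : 0 ≤ δ) (hκ' : 0 ≤ κ / 2 - δ / 2 * ((D : ℝ) ^ 2 * Real.sqrt d))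
    (hb₀ : 0 ≤ b₀) (hρ₃ : 0 ≤ ρ₃) (hρ₄ : 1 ≤ ρ₄) (hreg : b₀ ≤ b → M * b ^ (3 / 2 : ℝ) ≤ (v : ℝ)) (hM : ρ₃ + 1 ≤ δ / 2 * M) (k : ℕ) :
    2 ^ ((k + 1) * D) * 2 ^ 2 ^ ((k + 1) * D) * (max (max 1 C00) ((1 + 2 * d / α ^ 2) * (γ * c))) ^ ((k + 1) * D) *
        Real.exp (-(δ / 2 * ((v : ℝ) + 1))) *
        (A * Real.exp (δ / 2 * ((D : ℝ) ^ 2 * d)) * ((L : ℕ) : ℝ) ^ d * ∑ p ∈ Finset.Icc 1 s, ((admissible p D).card : ℝ) *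
            ((2 / (1 - Real.exp (-((κ / 2 - δ / 2 * ((D : ℝ) ^ 2 * Real.sqrt d)) / (p : ℕ) / Real.sqrt d))) *
              Real.exp ((κ / 2 - δ / 2 * ((D : ℝ) ^ 2 * Real.sqrt d)) / (p : ℕ) / Real.sqrt d)) ^ d) ^ (p - 1)) ^ (k + 1) ≤
      ((2 ^ ((k + 1) * D) * 2 ^ 2 ^ ((k + 1) * D) * (max 1 C00 + (1 + 2 * d / α ^ 2) * Γ) ^ ((k + 1) * D) *
          (Real.exp (δ / 2 * ((D : ℝ) ^ 2 * d)) * 2 ^ d * ∑ p ∈ Finset.Icc 1 D, ((admissible p D).card : ℝ) *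
            ((2 / (1 - Real.exp (-((κ / 2 - δ / 2 * ((D : ℝ) ^ 2 * Real.sqrt d)) / (p : ℕ) / Real.sqrt d))) *
              Real.exp ((κ / 2 - δ / 2 * ((D : ℝ) ^ 2 * Real.sqrt d)) / (p : ℕ) / Real.sqrt d)) ^ d) ^ (p - 1)) ^ (k + 1)) *
          (k + 1).factorial * (((k + 1) * D + 2 * d * (k + 1)).factorial +
            b₀ ^ ((k + 1) * D + 2 * d * (k + 1)) * Real.exp (ρ₃ * b₀ ^ (3 / 2 : ℝ)))) *
        (Real.exp (-(ρ₃ * b ^ (3 / 2 : ℝ))) * Real.exp (ρ₄ * A * b ^ ρ₃)) := by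
  have hb0 : 0 ≤ b := zero_le_one.trans hb
  obtain ⟨hSig0, hSigle⟩ := sum_adm_geom_nonneg_le hκ' s D d
  obtain ⟨hSigD0, -⟩ := sum_adm_geom_nonneg_le hκ' D D d
  set Sigs := ∑ p ∈ Finset.Icc 1 s, ((admissible p D).card : ℝ) *
      ((2 / (1 - Real.exp (-((κ / 2 - δ / 2 * ((D : ℝ) ^ 2 * Real.sqrt d)) / (p : ℕ) / Real.sqrt d))) *
        Real.exp ((κ / 2 - δ / 2 * ((D : ℝ) ^ 2 * Real.sqrt d)) / (p : ℕ) / Real.sqrt d)) ^ d) ^ (p - 1) with hSigs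
  set SigD := ∑ p ∈ Finset.Icc 1 D, ((admissible p D).card : ℝ) *
      ((2 / (1 - Real.exp (-((κ / 2 - δ / 2 * ((D : ℝ) ^ 2 * Real.sqrt d)) / (p : ℕ) / Real.sqrt d))) *
        Real.exp ((κ / 2 - δ / 2 * ((D : ℝ) ^ 2 * Real.sqrt d)) / (p : ℕ) / Real.sqrt d)) ^ d) ^ (p - 1) with hSigD
  clear_value Sigs SigD
  set K₀ := max (max 1 C00) ((1 + 2 * d / α ^ 2) * (γ * c)) with hK₀
  have hK₀0 : 0 ≤ K₀ := le_trans zero_le_one ((le_max_left _ _).trans (le_max_left _ _))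
  have hK₀le : K₀ ≤ (max 1 C00 + (1 + 2 * d / α ^ 2) * Γ) * b := K0_le hb hγ1 hc hcb
  clear_value K₀
  have hK₀pow : K₀ ^ ((k + 1) * D) ≤ (max 1 C00 + (1 + 2 * d / α ^ 2) * Γ) ^ ((k + 1) * D) * b ^ ((k + 1) * D) := by
    rw [← mul_pow]; exact pow_le_pow_left₀ hK₀0 hK₀le _
  have hLd := side_pow_le hL d
  have hMt : A * Real.exp (δ / 2 * ((D : ℝ) ^ 2 * d)) * ((L : ℕ) : ℝ) ^ d * Sigs ≤
      A * Real.exp (δ / 2 * ((D : ℝ) ^ 2 * d)) * (2 ^ d * b ^ (2 * d)) * SigD := by gcongr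
  have hMt0 : 0 ≤ A * Real.exp (δ / 2 * ((D : ℝ) ^ 2 * d)) * ((L : ℕ) : ℝ) ^ d * Sigs := by positivity
  have hMtpow : (A * Real.exp (δ / 2 * ((D : ℝ) ^ 2 * d)) * ((L : ℕ) : ℝ) ^ d * Sigs) ^ (k + 1) ≤
      (Real.exp (δ / 2 * ((D : ℝ) ^ 2 * d)) * 2 ^ d * SigD) ^ (k + 1) * b ^ (2 * d * (k + 1)) * A ^ (k + 1) := by
    have h := pow_le_pow_left₀ hMt0 hMt (k + 1)
    have hsplit : (A * Real.exp (δ / 2 * ((D : ℝ) ^ 2 * d)) * (2 ^ d * b ^ (2 * d)) * SigD) ^ (k + 1) =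
        (Real.exp (δ / 2 * ((D : ℝ) ^ 2 * d)) * 2 ^ d * SigD) ^ (k + 1) * b ^ (2 * d * (k + 1)) * A ^ (k + 1) := by
      have : A * Real.exp (δ / 2 * ((D : ℝ) ^ 2 * d)) * (2 ^ d * b ^ (2 * d)) * SigD =
          (Real.exp (δ / 2 * ((D : ℝ) ^ 2 * d)) * 2 ^ d * SigD) * (b ^ (2 * d) * A) := by ring
      rw [this]
      ring
    rw [hsplit] at h
    exact h
  have hreg' : b₀ ≤ b → M * b ^ (3 / 2 : ℝ) ≤ (v : ℝ) + 1 := fun h => (hreg h).trans (by linarith)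
  have hatom := decay_atom_le_snd (A := A) (b := b) (b₀ := b₀) (ρ₃ := ρ₃) (ρ₄ := ρ₄)
    (C := 2 ^ ((k + 1) * D) * 2 ^ 2 ^ ((k + 1) * D) * (max 1 C00 + (1 + 2 * d / α ^ 2) * Γ) ^ ((k + 1) * D) *
      (Real.exp (δ / 2 * ((D : ℝ) ^ 2 * d)) * 2 ^ d * SigD) ^ (k + 1))
    (c := δ / 2) (X := (v : ℝ) + 1) (M := M) (by positivity) hA hb hb₀ hρ₃ hρ₄ (by linarith) (by positivity) hreg' hM
    ((k + 1) * D + 2 * d * (k + 1)) (k + 1)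
  have hC1 : 0 ≤ (2 : ℝ) ^ ((k + 1) * D) * 2 ^ 2 ^ ((k + 1) * D) := by positivity
  calc 2 ^ ((k + 1) * D) * 2 ^ 2 ^ ((k + 1) * D) * K₀ ^ ((k + 1) * D) * Real.exp (-(δ / 2 * ((v : ℝ) + 1))) *
        (A * Real.exp (δ / 2 * ((D : ℝ) ^ 2 * d)) * ((L : ℕ) : ℝ) ^ d * Sigs) ^ (k + 1)
      ≤ 2 ^ ((k + 1) * D) * 2 ^ 2 ^ ((k + 1) * D) * ((max 1 C00 + (1 + 2 * d / α ^ 2) * Γ) ^ ((k + 1) * D) * b ^ ((k + 1) * D)) *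
          Real.exp (-(δ / 2 * ((v : ℝ) + 1))) *
          ((Real.exp (δ / 2 * ((D : ℝ) ^ 2 * d)) * 2 ^ d * SigD) ^ (k + 1) * b ^ (2 * d * (k + 1)) * A ^ (k + 1)) := by
        gcongr
    _ = (2 ^ ((k + 1) * D) * 2 ^ 2 ^ ((k + 1) * D) * (max 1 C00 + (1 + 2 * d / α ^ 2) * Γ) ^ ((k + 1) * D) *
          (Real.exp (δ / 2 * ((D : ℝ) ^ 2 * d)) * 2 ^ d * SigD) ^ (k + 1)) * b ^ ((k + 1) * D + 2 * d * (k + 1)) * A ^ (k + 1) *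
          Real.exp (-(δ / 2 * ((v : ℝ) + 1))) := by rw [pow_add]; ring
    _ ≤ _ := hatom
set_option maxHeartbeats 400000 in
/-- **ATOM (i4) — the (5.31) constant `δ₃₁(k+1)` of `perBox_at_pavement`'s `Err` fits the SECOND summand in both regimes**: with `θ` (print: `2d/(2d+α²)`)
in `(0,1)`, `C₀₀ ≥ 0` (print: `C₀₀`), `β ≥ 0`, depth `n = w − v` with `b₀ ≤ b → M·b^{3/2} ≤ w − v`, `ρ₃ + 1 ≤ (−log θ)·M`; `κ₀ := max 1 C₀₀ + (1+2d/α²)Γ`,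
`E := β·2d·C₀₀·Γ·2^d·(1+2√d) + 2d·C₀₀/α²`, `q := 2d(k+1) + (k+1)D + (2d+3)`, `C := (2^dΣ₁(D))^{k+1}·2^{(k+1)D}2^{2^{(k+1)D}}·((k+1)D)·κ₀^{(k+1)D}·E`:
`δ₃₁(k+1) ≤ (C·(k+1)!·(q! + b₀^q e^{ρ₃b₀^{3/2}}))·e^{−ρ₃b^{3/2}}e^{ρ₄Ab^{ρ₃}}`. [cite: BenfattoEtAl1978, (5.31) p.158, (C.8) p.165, (4.7) p.152] -/
theorem errPB_d31_le {C00 θ : ℝ} (hκ : 0 ≤ κ) (hA : 0 ≤ A) (hb : 1 ≤ b) (hΓ : 0 ≤ Γ) (hc : 0 ≤ c) (hcb : c ≤ Γ * b)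
    (hL1 : 1 ≤ ((L : ℕ) : ℝ)) (hL : ((L : ℕ) : ℝ) ≤ 2 * b ^ 2) (hγ0 : 0 ≤ γ) (hγ1 : γ ≤ 1) (hβ : 0 ≤ β) (hC00 : 0 ≤ C00)
    (hθ0 : 0 < θ) (hθ1 : θ < 1) (hb₀ : 0 ≤ b₀) (hρ₃ : 0 ≤ ρ₃) (hρ₄ : 1 ≤ ρ₄)
    (hreg : b₀ ≤ b → M * b ^ (3 / 2 : ℝ) ≤ ((w - v : ℕ) : ℝ)) (hM : ρ₃ + 1 ≤ -Real.log θ * M) (k : ℕ) :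
    (A * ((L : ℕ) : ℝ) ^ d * ∑ p ∈ Finset.Icc 1 s, ((admissible p D).card : ℝ) *
          ((2 / (1 - Real.exp (-(κ / 2 / (p : ℕ) / Real.sqrt d))) * Real.exp (κ / 2 / (p : ℕ) / Real.sqrt d)) ^ d) ^ (p - 1)) ^ (k + 1) *
      (2 ^ ((k + 1) * D) * 2 ^ 2 ^ ((k + 1) * D) *
        ((((k + 1) * D : ℕ) : ℝ) * (max (max 1 C00) ((1 + 2 * d / α ^ 2) * (γ * c))) ^ ((k + 1) * D) *
          max (β * (2 * d * (C00 * θ ^ (w - v))) * (γ * c * (((L : ℕ) : ℝ) ^ d * (1 + Real.sqrt d * (((L : ℕ) : ℝ) - 1)))))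
            (2 * d * C00 * θ ^ (w - v) / α ^ 2))) ≤
      (((2 ^ d * ∑ p ∈ Finset.Icc 1 D, ((admissible p D).card : ℝ) *
            ((2 / (1 - Real.exp (-(κ / 2 / (p : ℕ) / Real.sqrt d))) * Real.exp (κ / 2 / (p : ℕ) / Real.sqrt d)) ^ d) ^ (p - 1)) ^ (k + 1) *
          (2 ^ ((k + 1) * D) * 2 ^ 2 ^ ((k + 1) * D)) * (((k + 1) * D : ℕ) : ℝ) * (max 1 C00 + (1 + 2 * d / α ^ 2) * Γ) ^ ((k + 1) * D) *
          (β * (2 * d) * C00 * Γ * 2 ^ d * (1 + 2 * Real.sqrt d) + 2 * d * C00 / α ^ 2)) *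
          (k + 1).factorial * ((2 * d * (k + 1) + (k + 1) * D + (2 * d + 3)).factorial +
            b₀ ^ (2 * d * (k + 1) + (k + 1) * D + (2 * d + 3)) * Real.exp (ρ₃ * b₀ ^ (3 / 2 : ℝ)))) *
        (Real.exp (-(ρ₃ * b ^ (3 / 2 : ℝ))) * Real.exp (ρ₄ * A * b ^ ρ₃)) := by
  have hb0 : 0 ≤ b := zero_le_one.trans hb
  obtain ⟨hSig0, hSigle⟩ := sum_adm_geom_nonneg_le (X := κ / 2) (by linarith) s D d
  obtain ⟨hSigD0, -⟩ := sum_adm_geom_nonneg_le (X := κ / 2) (by linarith) D D d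
  set Sigs := ∑ p ∈ Finset.Icc 1 s, ((admissible p D).card : ℝ) *
      ((2 / (1 - Real.exp (-(κ / 2 / (p : ℕ) / Real.sqrt d))) * Real.exp (κ / 2 / (p : ℕ) / Real.sqrt d)) ^ d) ^ (p - 1) with hSigs
  set SigD := ∑ p ∈ Finset.Icc 1 D, ((admissible p D).card : ℝ) *
      ((2 / (1 - Real.exp (-(κ / 2 / (p : ℕ) / Real.sqrt d))) * Real.exp (κ / 2 / (p : ℕ) / Real.sqrt d)) ^ d) ^ (p - 1) with hSigD
  clear_value Sigs SigD
  set K₀ := max (max 1 C00) ((1 + 2 * d / α ^ 2) * (γ * c)) with hK₀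
  set n : ℕ := w - v with hn
  have hθn : 0 ≤ θ ^ n := pow_nonneg hθ0.le n
  have hK₀0 : 0 ≤ K₀ := le_trans zero_le_one ((le_max_left _ _).trans (le_max_left _ _))
  have hK₀le : K₀ ≤ (max 1 C00 + (1 + 2 * d / α ^ 2) * Γ) * b := K0_le hb hγ1 hc hcb
  clear_value K₀
  have hK₀pow : K₀ ^ ((k + 1) * D) ≤ (max 1 C00 + (1 + 2 * d / α ^ 2) * Γ) ^ ((k + 1) * D) * b ^ ((k + 1) * D) := by
    rw [← mul_pow]; exact pow_le_pow_left₀ hK₀0 hK₀le _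
  have hLd := side_pow_le hL d
  have hLd0 : 0 ≤ ((L : ℕ) : ℝ) ^ d := by positivity
  -- the mass power
  have hM1 : A * ((L : ℕ) : ℝ) ^ d * Sigs ≤ A * (2 ^ d * b ^ (2 * d)) * SigD := by gcongr
  have hM0 : 0 ≤ A * ((L : ℕ) : ℝ) ^ d * Sigs := by positivity
  have hMpow : (A * ((L : ℕ) : ℝ) ^ d * Sigs) ^ (k + 1) ≤ (2 ^ d * SigD) ^ (k + 1) * b ^ (2 * d * (k + 1)) * A ^ (k + 1) := by
    have h := pow_le_pow_left₀ hM0 hM1 (k + 1)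
    have hsplit : (A * (2 ^ d * b ^ (2 * d)) * SigD) ^ (k + 1) = (2 ^ d * SigD) ^ (k + 1) * b ^ (2 * d * (k + 1)) * A ^ (k + 1) := by
      have : A * (2 ^ d * b ^ (2 * d)) * SigD = (2 ^ d * SigD) * (b ^ (2 * d) * A) := by ring
      rw [this]
      ring
    rw [hsplit] at h
    exact h
  -- `ε₃₁ ≤ E·θⁿ·b^{2d+3}`
  have hb2 : 1 ≤ b ^ 2 := by nlinarith
  have hγc : γ * c ≤ Γ * b := (mul_le_of_le_one_left hc hγ1).trans hcb
  have hgeomL : 1 + Real.sqrt d * (((L : ℕ) : ℝ) - 1) ≤ (1 + 2 * Real.sqrt d) * b ^ 2 := by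
    have hd0 : 0 ≤ Real.sqrt d := Real.sqrt_nonneg _
    have h1 : ((L : ℕ) : ℝ) - 1 ≤ 2 * b ^ 2 := by linarith
    nlinarith [mul_le_mul_of_nonneg_left h1 hd0]
  have hT₁ : β * (2 * d * (C00 * θ ^ n)) * (γ * c * (((L : ℕ) : ℝ) ^ d * (1 + Real.sqrt d * (((L : ℕ) : ℝ) - 1)))) ≤
      (β * (2 * d) * C00 * Γ * 2 ^ d * (1 + 2 * Real.sqrt d)) * θ ^ n * b ^ (2 * d + 3) := by
    have hgl0 : 0 ≤ 1 + Real.sqrt d * (((L : ℕ) : ℝ) - 1) := by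
      have : 0 ≤ Real.sqrt d * (((L : ℕ) : ℝ) - 1) := mul_nonneg (Real.sqrt_nonneg _) (by linarith)
      linarith
    calc β * (2 * d * (C00 * θ ^ n)) * (γ * c * (((L : ℕ) : ℝ) ^ d * (1 + Real.sqrt d * (((L : ℕ) : ℝ) - 1))))
        ≤ β * (2 * d * (C00 * θ ^ n)) * ((Γ * b) * ((2 ^ d * b ^ (2 * d)) * ((1 + 2 * Real.sqrt d) * b ^ 2))) := by
          gcongr
      _ = (β * (2 * d) * C00 * Γ * 2 ^ d * (1 + 2 * Real.sqrt d)) * θ ^ n * b ^ (2 * d + 3) := by ring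
  have hT₂ : 2 * d * C00 * θ ^ n / α ^ 2 ≤ (2 * d * C00 / α ^ 2) * θ ^ n * b ^ (2 * d + 3) := by
    have h1 : 1 ≤ b ^ (2 * d + 3) := one_le_pow₀ hb
    have h0 : 0 ≤ 2 * d * C00 / α ^ 2 * θ ^ n := by positivity
    calc 2 * d * C00 * θ ^ n / α ^ 2 = (2 * d * C00 / α ^ 2) * θ ^ n * 1 := by ring
      _ ≤ (2 * d * C00 / α ^ 2) * θ ^ n * b ^ (2 * d + 3) := mul_le_mul_of_nonneg_left h1 h0
  have hT₁0 : 0 ≤ (β * (2 * d) * C00 * Γ * 2 ^ d * (1 + 2 * Real.sqrt d)) * θ ^ n * b ^ (2 * d + 3) := by positivity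
  have hT₂0 : 0 ≤ (2 * d * C00 / α ^ 2) * θ ^ n * b ^ (2 * d + 3) := by positivity
  have hε : max (β * (2 * d * (C00 * θ ^ n)) * (γ * c * (((L : ℕ) : ℝ) ^ d * (1 + Real.sqrt d * (((L : ℕ) : ℝ) - 1)))))
        (2 * d * C00 * θ ^ n / α ^ 2) ≤
      (β * (2 * d) * C00 * Γ * 2 ^ d * (1 + 2 * Real.sqrt d) + 2 * d * C00 / α ^ 2) * θ ^ n * b ^ (2 * d + 3) := by
    have hsum : (β * (2 * d) * C00 * Γ * 2 ^ d * (1 + 2 * Real.sqrt d) + 2 * d * C00 / α ^ 2) * θ ^ n * b ^ (2 * d + 3) =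
        (β * (2 * d) * C00 * Γ * 2 ^ d * (1 + 2 * Real.sqrt d)) * θ ^ n * b ^ (2 * d + 3) + (2 * d * C00 / α ^ 2) * θ ^ n * b ^ (2 * d + 3) := by
      ring
    rw [hsum]
    exact max_le (hT₁.trans (le_add_of_nonneg_right hT₂0)) (hT₂.trans (le_add_of_nonneg_left hT₁0))
  have hε0 : 0 ≤ max (β * (2 * d * (C00 * θ ^ n)) * (γ * c * (((L : ℕ) : ℝ) ^ d * (1 + Real.sqrt d * (((L : ℕ) : ℝ) - 1)))))
        (2 * d * C00 * θ ^ n / α ^ 2) := le_max_of_le_right (by positivity)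
  have hatom := pow_atom_le_snd (A := A) (b := b) (b₀ := b₀) (ρ₃ := ρ₃) (ρ₄ := ρ₄)
    (C := (2 ^ d * SigD) ^ (k + 1) * (2 ^ ((k + 1) * D) * 2 ^ 2 ^ ((k + 1) * D)) * (((k + 1) * D : ℕ) : ℝ) *
      (max 1 C00 + (1 + 2 * d / α ^ 2) * Γ) ^ ((k + 1) * D) * (β * (2 * d) * C00 * Γ * 2 ^ d * (1 + 2 * Real.sqrt d) + 2 * d * C00 / α ^ 2))
    (θ := θ) (M := M) (n := n) (by positivity) hA hb hb₀ hρ₃ hρ₄ hθ0 hθ1 hreg hM (2 * d * (k + 1) + (k + 1) * D + (2 * d + 3)) (k + 1)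
  have hΦ0 : 0 ≤ (2 : ℝ) ^ ((k + 1) * D) * 2 ^ 2 ^ ((k + 1) * D) := by positivity
  have hkD0 : 0 ≤ (((k + 1) * D : ℕ) : ℝ) := Nat.cast_nonneg _
  calc (A * ((L : ℕ) : ℝ) ^ d * Sigs) ^ (k + 1) * (2 ^ ((k + 1) * D) * 2 ^ 2 ^ ((k + 1) * D) * ((((k + 1) * D : ℕ) : ℝ) * K₀ ^ ((k + 1) * D) *
          max (β * (2 * d * (C00 * θ ^ n)) * (γ * c * (((L : ℕ) : ℝ) ^ d * (1 + Real.sqrt d * (((L : ℕ) : ℝ) - 1)))))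
            (2 * d * C00 * θ ^ n / α ^ 2)))
      ≤ ((2 ^ d * SigD) ^ (k + 1) * b ^ (2 * d * (k + 1)) * A ^ (k + 1)) * (2 ^ ((k + 1) * D) * 2 ^ 2 ^ ((k + 1) * D) *
          ((((k + 1) * D : ℕ) : ℝ) * ((max 1 C00 + (1 + 2 * d / α ^ 2) * Γ) ^ ((k + 1) * D) * b ^ ((k + 1) * D)) *
            ((β * (2 * d) * C00 * Γ * 2 ^ d * (1 + 2 * Real.sqrt d) + 2 * d * C00 / α ^ 2) * θ ^ n * b ^ (2 * d + 3)))) := by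
        gcongr
    _ = ((2 ^ d * SigD) ^ (k + 1) * (2 ^ ((k + 1) * D) * 2 ^ 2 ^ ((k + 1) * D)) * (((k + 1) * D : ℕ) : ℝ) *
          (max 1 C00 + (1 + 2 * d / α ^ 2) * Γ) ^ ((k + 1) * D) * (β * (2 * d) * C00 * Γ * 2 ^ d * (1 + 2 * Real.sqrt d) + 2 * d * C00 / α ^ 2)) *
          b ^ (2 * d * (k + 1) + (k + 1) * D + (2 * d + 3)) * A ^ (k + 1) * θ ^ n := by rw [pow_add, pow_add]; ring
    _ ≤ _ := hatom

end ErrPBAtoms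

end Literature.MathematicalPhysics.QuantumFieldTheory.Balaban1983to89.B1Eq324BenfattoSect5LedgerDischarge

end
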